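import Summits.AtomisticToContinuum.HydrodynamicLimit.Theses.StiffCollisionalRelaxation
import Summits.AtomisticToContinuum.HydrodynamicLimit.Theses.CollisionIsometryCLT
import Summits.AtomisticToContinuum.HydrodynamicLimit.Theorems.StiffCollisionalRelaxationAprioriBoundsFibreDefs
import Summits.AtomisticToContinuum.HydrodynamicLimit.Theorems.StiffCollisionalRelaxationAprioriBoundsFibreDefsR4
import Summits.AtomisticToContinuum.HydrodynamicLimit.Theorems.StiffCollisionalRelaxationAprioriBoundsMesoPartTwoOfMeanVariance
import Summits.AtomisticToContinuum.HydrodynamicLimit.Theorems.StiffCollisionalRelaxationAprioriBoundsMesoPartOneOfVarianceTails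
import Summits.AtomisticToContinuum.HydrodynamicLimit.Theorems.StiffCollisionalRelaxationAprioriBoundsMesoPairCorrelationGlue
import Summits.AtomisticToContinuum.HydrodynamicLimit.Theorems.StiffCollisionalRelaxationAprioriBoundsMesoPairDecorrelationGlue
import Summits.AtomisticToContinuum.HydrodynamicLimit.Theorems.StiffCollisionalRelaxationAprioriBoundsMesoPartOneOfOccupation
import Summits.AtomisticToContinuum.HydrodynamicLimit.Theorems.StiffCollisionalRelaxationAprioriBoundsMesoOccupationInProb
import Summits.AtomisticToContinuum.HydrodynamicLimit.Theorems.StiffCollisionalRelaxationAprioriBoundsMesoCapstones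
import Summits.AtomisticToContinuum.HydrodynamicLimit.Theorems.StiffCollisionalRelaxationAprioriBoundsMesoOccupationInProbExact
import Summits.AtomisticToContinuum.HydrodynamicLimit.Theorems.StiffCollisionalRelaxationAprioriBoundsPartTwoOfKineticRangeControl

/-!
# Line `meso-chebyshev-window` for the crux `AprioriBounds` (stmt-AtomisticToContinuum-14827) — skeleton r5
(lead c11 = prover-line-stmt-AtomisticToContinuum-14827-c11-0, cycle 4, 2026-08-17T18:05Z; r3: lead c10, cycle 3; r1: crux-plan
planner-cruxplan-stmt-AtomisticToContinuum-14827-meso-chebyshev-windo-0, card `Cruxes/AprioriBounds/Ideas/meso-chebyshev-window.md`,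
ideator 5, round 2, triage TRIAGE-r2-1 / TRIAGE-r2-2 pass / pass; r2: lead a2, cycle 1 — stubs 4 and 7 of r1 DISCHARGED (p145137, p145949),
capstones p147849; lead c9, cycle 2 — r2 unchanged, `s = 0` inhomogeneous rungs of stubs 1–3 landed p164149 / p164905 (+ p164392,
p164073, p164308, p164204).)

## r5 (THIS CYCLE, second reshape): THE REGISTERED STUBS ARE THE EXACT RESIDUE — II `partTwo`, 5 `farTailAll`, 6 `occupationInProb`
Three sorries, three open things: stub II = component (ii) under the prefix (NECESSARY trivially; ⇐ stmt-9201 alone by the landed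
`AdiabatCeiling.partTwo_of_kineticRangeControl`, or 9201-free ⇐ this line's three (ii)-leaves `meanFloor ∧ meanCeiling ∧ pairCorrelation`, kept BY NAME with
all their glue and rungs: `partTwo_of_meanBands`); stub 5 = far tails in the mean (⇐ stmt-14415, p137042; NOT implied by the crux — means see the rare
all-fast events that (i) ignores); stub 6 = the in-probability occupation profile (NECESSARY, p172293).  Kernel-checked in the tree (p172293):
`GaussianTails → (AprioriBounds ↔ PartTwoPrefix ∧ OccupationInProbPrefix)` and `KineticRangeControl → GaussianTails → (AprioriBounds ↔ OccupationInProbPrefix)`;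
so the crux is CLOSED MODULO {9201, 14415, OccupationInProbPrefix} with the third child a corollary of the crux (D3-SPLIT-R4.md), or modulo
{PartTwoPrefix, 14415, OccupationInProbPrefix} with two corollary children (D3″).  r4's and r3's registered sets still close it (examples at the end).

## r4 (this cycle, first reshape): THE (i)-RESIDUE MADE EXACT — the registered (i)-stub is now NECESSARY for the crux
Cycles 1–3 produced component (i) from SUFFICIENT concentration stubs — r2 `occupationVariance` ⟺ r3 `pairDecorrelation`
⟸ `FixedTimeTailVariance` ⟸ stmt-17603 — none of which the crux implies (an `N`-independent random modulation of the far
tails breaks each with (i) intact: the shape of the landed witness `expMoment_bounds_not_sufficient`).  The hypothesis of the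
LANDED dial `stub_partOne_of_occupation` (p142615), the IN-PROBABILITY OCCUPATION PROFILE
  `∃ Θ > 0, A, ∀ K, ∀ η > 0, P_N{ t·A·e^{−K/(2Θ)} + η < occ_K } → 0`     (`occ_K = ∫₀ᵗ frac_K(Φ_s ·) ds ∈ [0,t]`),
is instead a COROLLARY of (i): on a good orbit `e^{λK}·occ_K ≤ ∫₀ᵗ(N+1)⁻¹∑ᵢe^{λ|vᵢ(s)|²}ds` for every `K` (Markov at one
configuration, `FibreDeficitTransfer.frac_le_exp_neg_mul_avg`, integrated in time), so `P_N{C⁺e^{−λK} + η < occ_K} ≤ P_N{C < X_N} → 0`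
with `Θ := 1/(2λ)`, `A := C⁺/t`.  Lead c11's support file `Theorems/…MesoOccupationInProbExact.lean` (this cycle) proves
`occupationInProb_of_partOne`, `partOne_iff_occupationInProb` (given `FarTailAllAt`), `occupationInProb_of_aprioriBounds` and the
capstones `AprioriBounds_of_KRC_GT_occupationInProb`, `aprioriBounds_iff_partTwo_and_occupationInProb_of_GT`
(**given stmt-14415: crux ⟺ (ii)-prefix ∧ OccupationInProbPrefix**) and `aprioriBounds_iff_occupationInProb_of_KRC_GT`
(**given 9201 ∧ 14415: crux ⟺ OccupationInProbPrefix**).  Hence r4: registered stub 6 becomes `stub_occupationInProb` (OPEN,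
NECESSARY — a refutation of it refutes the crux; its equilibrium rung is inherited from the PROVED equilibrium (i),
`occupationInProb_homogeneous`), stub 7 becomes the CLOSED dial `stub_partOne_of_occupation` (p142615); the r3 pair
`pairDecorrelation` / `occupationVariance_of_pairDecorrelation` is kept BY NAME as a DOCK (`occupationVariance_of`,
`occupationInProb_of`: r3-stub 6 ⟹ r2-stub 6 ⟹ (∧ stub 5) r4-stub 6; closing `example` at the end), so every landed r3 producer / capstone still applies.
Registered open stubs r4: 1 `meanFloor` (⇐ 9201), 2 `meanCeiling` (⇐ 9201), 3 `pairCorrelation` (9201-free (ii) only), 5 `farTailAll`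
(⇐ 14415), 6 `occupationInProb` (EXACT (i)-residue; ⇐ occupationVariance ⇐ pairDecorrelation ⇐ FixedTimeTailVariance ⇐ 17603).
The planner's D3 third child should be filed as `OccupationInProbPrefix` (the signature of `Holds.stub_occupationInProb`, `frac`
inlined by `rfl`): the split `14827 ⇐ 9201 ∧ 14415 ∧ C3` is then LOSSLESS (`C3 ⇐ 14827`).

## r3 (lead c10, cycle 3): THE RESIDUE TYPED AT BBGKY LEVEL TWO — exchangeability reduction of the two variance stubs
The evolved local Gibbs law `P_N ∘ (Φ_s)⁻¹` is EXCHANGEABLE (tree: relabelling preserves `P_N` for all profiles,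
`EvenStressEnskog.measurePreserving_comp_perm_localGibbsLaw`; every hard-sphere flow commutes with relabelling `P_N`-a.e. at all
forward times simultaneously, `ShearStressHalfDrudeRelabel.ae_forall_flow_comp_perm_of_nonneg_localGibbsLaw`, from forward uniqueness
`HardSphereFlow.flow_comp_perm_ae`).  Hence for every one-particle functional `gᵢ(z) = g((Φ_· z)ᵢ)` of the forward orbit
(one-time or time-window) the Bienaymé identity with identical rows holds EXACTLY:
  `Var_{P_N}((N+1)⁻¹ ∑ᵢ gᵢ) = (N+1)⁻¹ · Var g₀ + (N/(N+1)) · Cov(g₀, g₁)`.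
* r2-stub 3 `mesoVariance` (Poisson-order variance of the kernel block density) has diagonal `(N+1)⁻¹ Var φ_N(q₀(s)−x) ≤
  ‖φ_N‖_∞ · E ρ̄_φ(s,x)/(N+1) ≤ C(N+1)^{3γ−1} · E ρ̄_φ(s,x)` — POISSON ORDER FOR FREE given any order-one MEAN CEILING (r2-stub 2 gives
  `E ρ̄ ≤ κ/σ³`); what is left is the off-diagonal term, the EQUAL-TIME TRUNCATED PAIR CORRELATION of two tagged spheres tested against
  `φ_N ⊗ φ_N`: NEW registered stub 3 `stub_pairCorrelation` (`Cov_{P_N}(φ_N(q₀(s)−x), φ_N(q₁(s)−x)) ≤ A(N+1)^{3γ−1}`), glued back by the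
  provable-now stub 4 `stub_mesoVariance_of_pairCorrelation` (mean ceiling ∧ pair correlation ⟹ r2-stub 3 verbatim).  Conversely r2-stub 3 ⟹
  stub 3 (`Cov ≤ ((N+1)/N)·Var`), so `(2 ∧ 3_r2) ⟺ (2 ∧ 3_r3)`: nothing is lost.
* r2-stub 6 `occupationVariance` (`Var_{P_N} occ_K → 0`, `occ_K = ∫₀ᵗ frac_K(Φ_s·) ds = (N+1)⁻¹ ∑ᵢ ζᵢ^K`, `ζᵢ^K(z) = |{s ∈ [0,t] : K ≤
  |vᵢ(s)|²}|` the TIME-AVERAGED TAIL SOJOURN of sphere `i`) has diagonal `(N+1)⁻¹ Var ζ₀ ≤ t²/(N+1) → 0` for free; what is left is the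
  DECORRELATION OF TWO TAGGED SPHERES' SOJOURNS: NEW registered stub 6 `stub_pairDecorrelation` (`Cov_{P_N}(ζ₀^K, ζ₁^K) → 0` for every `K`),
  glued back by the provable-now stub 7 `stub_occupationVariance_of_pairDecorrelation`; conversely r2-stub 6 ⟹ stub 6
  (`Cov = ((N+1)Var occ − Var ζ₀)/N`), so stub 6_r3 ⟺ stub 6_r2 = the D3 child `OccupationVariance` (D3-SPLIT.md) — the planner may file
  either text; the pair form is the literature's currency (second cumulant / correlation error `f_N^{(2)} − f^{(1)} ⊗ f^{(1)}` of two tagged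
  spheres, Pulvirenti–Simonella 2017, Bodineau–Gallagher–Saint-Raymond–Simonella 2023 — all Boltzmann–Grad, kinetic times; here Euler
  scaling, `≍ σ²N^{1/3}t` mean free times: open in kind, as every positive-time input of this crux).
Registered stubs r3 (7 = stubs_max): 1 `meanFloor`, 2 `meanCeiling` (unchanged, ⇐ 9201), 3 `pairCorrelation` (OPEN, lead), 4
`mesoVariance_of_pairCorrelation` (PROVABLE NOW), 5 `farTailAll` (unchanged, ⇐ 14415), 6 `pairDecorrelation` (OPEN), 7
`occupationVariance_of_pairDecorrelation` (PROVABLE NOW).  The r2 statements `stub_mesoVariance` / `stub_occupationVariance` are kept BY NAME as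
DERIVED theorems (`Holds.stub_mesoVariance` from 2 ∧ 3 ∧ 4, `Holds.stub_occupationVariance` from 6 ∧ 7), so every landed r2 glue / capstone
(p145137, p145949, p147849 `AprioriBounds_of_meso_stubs`, `AprioriBounds_of_KRC_GT_occupationVariance`) applies verbatim.

## STATE AFTER CYCLE 3 (lead c10; skeleton r3a: rc 0, 5 sorries = stubs 1, 2, 3, 5, 6; six accepted proposals)
* CLOSED: stub 4 `stub_mesoVariance_of_pairCorrelation` (p167966, + converse `pairCorrelation_of_mesoVariance`, rungs `pairCorrelation_homogeneous`
  / `pairCorrelation_timeZero`), stub 7 `stub_occupationVariance_of_pairDecorrelation` (p168171, + converse `pairDecorrelation_of_occupationVariance`,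
  rung `pairDecorrelation_homogeneous`).  Capstones r3 (p169401, `…MesoCapstonesR3.lean`): `AprioriBounds_of_r3_stubs` (importable twin of this
  file's `AprioriBounds_of`), `AprioriBounds_of_KRC_GT_pairDecorrelation`, `AprioriBounds_of_KRC_GT_fixedTimeTailVariance`,
  **`AprioriBounds_of_KRC_GT_maxwellianOneBodyInBand` (+PreShock) = THE CRUX FROM THREE EXISTING ITEMS 9201 ∧ 14415 ∧ 17603**.
* DOCKED: stub 6 `pairDecorrelation` ⇐ `AnosovDiceHopf.MaxwellianOneBodyInBand` (stmt-17603; p168989) and ⇐ the one-body fixed-time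
  identification-free `FixedTimeTailVariance` (`∀ K, ∀ s ∈ [0,t], Var_{P_N}(frac_K ∘ Φ_s) → 0`; Cauchy–Schwarz in time, p168597), whose rungs
  (equilibrium at all `s`, `s = 0` for every nice profile) are p169824.  Hierarchy of third children (kernel-checked):
  `17603 ⟹ FixedTimeTailVariance ⟹ OccupationVariance ⟺ PairDecorrelation ⟹ (∧ FarTailAllAt) PartOneAt`.
* OPEN (unchanged in kind): stub 1 ⇐ 9201, stub 2 ⇐ 9201, stub 5 ⇐ 14415, stub 6 ⇐ 17603; stub 3 `pairCorrelation` has no producer and no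
  dock but is consumed ONLY by the 9201-free (ii) (`partTwo_of_meanBands_pairCorrelation`), i.e. it is off the critical path once 9201 is a child.

## STATE CARRIED OVER (r2, leads a2/c9; all `--supports 14827`, namespace `Theorems.MesoChebyshevWindow`)
* CLOSED r1-stubs: `stub_partTwo_of_meanVariance` (p145137; tools p143177, p144405), `stub_partOne_of_varianceTails` (p145949 = p142450 ∘ p142615).
* Docks (open producers): stub 1 ⇐ 9201 (`meanFloor_of_kineticRangeControl` p142675), stub 2 ⇐ 9201 (`meanCeiling_of_kineticRangeControl`
  p143118), stub 5 ⇐ 14415 (`farTailAll_of_gaussianTails` p137042), r2-stub 6 ⇐ 13619 + unfiled influence (p143188).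
* Rungs: equilibrium (constant profiles, every flow family) p142677 / p142800 / p148322 (`mesoVariance_homogeneous`, Poisson order) / p143623
  (`Var occ_K ≤ t²/(4(N+1))`); `s = 0` for EVERY nice profile p164149 (`tzMean_meanFloor_timeZero`, `tzMean_meanCeiling_timeZero`) / p164905
  (`mesoVariance_timeZero`, quantitative inhomogeneous canonical cluster expansion).  The rungs transfer to the r3 stubs 3 / 6 through the
  converse inequalities above (one line each).
* Disproof.lean unchanged since 2026-08-16T12:30Z (cycle 4, rc 0, 2719 lines; no `-- Targets` on this line); no `stub-false` / `stub-misstated`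
  from any worker or the disprover in cycles 1–2.

Crux decl: `Summit.AtomisticToContinuum.HydrodynamicLimit.Theses.StiffCollisionalRelaxation.AprioriBounds` (rank 4)
= `…Theses.CollisionIsometryCLT.AprioriBoundsPreShock` (rank 5), one `Prop` (`AprioriBoundsNegative.aprioriBounds_iff`:
crux prefix → `PartOneAt ∧ PartTwoAt`).  This skeleton concludes BOTH by name (`AprioriBounds_of`, `AprioriBoundsPreShock_of`).

## The line in one sentence (unchanged)

Component (ii) at the crux's kernel scales `h = (N+1)^{-γ}`, `γ ≤ 1/15`, is a supremum over a continuum of cells and times that a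
space–time grid of `O((N+1)^{7γ})` points controls (pathwise Lipschitz moduli from the landed packing count and displacement bound), so
CHEBYSHEV at each grid point needs only the MEAN (floor, stub 1; ceiling, stub 2) and a POISSON-ORDER VARIANCE (`(N+1)^{7γ}·Var/δ² → 0` iff
`Var ≤ A(N+1)^{3γ−1}`, `10γ < 1`) of the one-body random variable `ρ̄_φ(s,x)` — CLOSED glue p145137; by exchangeability the variance is
Poisson on the diagonal and a truncated PAIR CORRELATION off it (stubs 3–4).  Component (i) = SIZE in the mean (`FarTailAllAt` ⇐ 14415,
stub 5) × CONCENTRATION of the time-integrated tail occupations (CLOSED glue p145949: Chebyshev at each level ∘ the λ-dial), and by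
exchangeability the concentration is the decorrelation of two tagged spheres' sojourns (stubs 6–7).  Neither half identifies a limit, names
an Euler field, or asks a rate beyond Poisson order.

## Why the dead lines' deaths cannot recur here (unchanged)

`Sketch` (dead 2026-08-16T21:12Z) asked RATED fixed-point cell probabilities and docked (i) into a fixed-time velocity LLN (identification);
here the per-point failure `o((N+1)^{-7γ})` is a SECOND MOMENT and (i) is size × concentration.  `fibre-deficit-transfer` (dead
2026-08-17T02:20Z at `stub_linStatL1` = hydrodynamics in the mean on `[0,t]`, conjunct-strength, circular): no stub below asks convergence
of any statistic to any Euler value — stubs 1–2 are one-sided BANDS in the mean with slack, stub 3 an ORDER bound with a free constant,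
stub 6 a vanishing covariance.

## Disproof used (`Cruxes/AprioriBounds/Disproof.lean`, cycle 4)

§2 (tightness `σ³ ≤ 1`, `c₁ ≤ 1`): the composition takes `c₁ = m/2` at `σ ≤ 1/2`; §3/§3d (smallness of `σ` load-bearing for (ii)):
honoured — `σ ≤ 1/2 < σ₀` at the CLOSED glue, `σ < σ₀`, `η₁` spent at stub 2; §9c (`2σ³ < η₁` free) consistent with stub 2; §9d
equilibrium rung: EVERY r3 stub has a TRUE equilibrium instance (stubs 3 / 6 inherit p148322 / p143623 through `Cov ≤ ((N+1)/N)·Var`);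
§9e/§9g (`∀λ` false): `λ` is dialled inside the closed (i)-glue; §9f: `c₁ = m/2 ≤ 1/2` on the rung; §7–§8 live at `t ≥ T` — every open
stub carries `t < T`.  No `_false_without_` theorem has a hypothesis instantiated by a stub; no landed `Negative/*` lemma applies.
-/

noncomputable section

open MeasureTheory ProbabilityTheory Filter Set Topology
open scoped ENNReal

namespace Summit.AtomisticToContinuum.HydrodynamicLimit.Cruxes.AprioriBounds.MesoChebyshevWindow

open Literature.MathematicalPhysics.KineticTheory Literature.Analysis.FluidPDE
open Summit.AtomisticToContinuum.HydrodynamicLimit.Theorems.AprioriBoundsNegative (PartOneAt PartTwoAt)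
open Summit.AtomisticToContinuum.HydrodynamicLimit.Theorems.VisitLedgerUpscattering (Cfg Flow Flows NiceProfiles)
open Summit.AtomisticToContinuum.HydrodynamicLimit.Theorems.FibreDeficitTransfer

/-! ## Registered stubs (bodies `sorry`; every signature self-contained over LANDED vocabulary:
`empiricalDensityField` / `empiricalEnergyField` / `localGibbsLaw` (`Literature…KineticTheory.HardSphereEuler`), the crux's
admissible-kernel block VERBATIM (as in `AprioriBoundsNegative.PartTwoAt`), Mathlib's `ProbabilityTheory.variance` / `MemLp`,
`frac` (`…AprioriBoundsFibreDefs`), `FarTailAllAt` (`…FibreDefsR4`), `PartOneAt` (`…Negative.EquilibriumRung`), `NiceProfiles`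
(`…VisitLedgerDefs`).  The block density at `(s, x)` is `empiricalDensityField ((Φ N).flow s z) (fun y => φ N (y - x)) =
(N+1)⁻¹ ∑ᵢ φ_N(qᵢ(s) − x)`; the tagged spheres are the labels `0, 1 : Fin (N + 1)` (for `N = 0` they coincide — every stub is
`eventually in N`); the tail sojourn of sphere `i` at level `K` is written inline as
`(∫⁻ s in Icc 0 t, ENNReal.ofReal (if K ≤ ‖((Φ N).flow s z i).2‖ ^ 2 then 1 else 0)).toReal`, so that
`occ_K = (∫⁻ s in Icc 0 t, ENNReal.ofReal (frac K ((Φ N).flow s z))).toReal = (N+1)⁻¹ ∑ᵢ ζᵢ^K` by `frac_eq_avg` and Tonelli on good orbits;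
covariances are written as `E[XY] − E[X]E[Y]` (Bochner integrals against the probability law `P_N`). -/

namespace Holds

/-- STUB II `partTwo` (OPEN — NEW as a REGISTERED stub in r5; the EXACT (ii)-residue).  Component (ii) of the crux under the crux prefix,
verbatim (`PartTwoAt`: for every admissible kernel family at scales `(N+1)^{-γ}`, `γ ≤ 1/15`, `∃ c₁ > 0` with
`P_N{∃ s ≤ t, ∃ x, ρ̄_φ(s,x) < c₁ ∨ 1 < ρ̄_φ(s,x)σ³} → 0` — no empty and no jammed mesoscopic cell before `T`).  Trivially NECESSARY
(`stub_partTwo_of_aprioriBounds` below).  PRODUCERS (sorry-free glue in this file / landed): the existing item `KineticRangeControl` stmt-9201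
ALONE (`partTwo_of_kineticRangeControl'` := `AdiabatCeiling.partTwo_of_kineticRangeControl`, landed; 9201 is STRONGER: all kinetic scales `≫ log N`
spheres per block, momentum / energy / temperature bands) — or, 9201-free, THIS LINE'S mesoscopic Chebyshev window: the by-name (ii)-leaves
`stub_meanFloor` (floor in the mean; itself NECESSARY for (ii), `Theorems.MesoChebyshevWindow.meanFloor_of_partTwo` p142675) ∧ `stub_meanCeiling`
(ceiling in the mean, `κ < 1`) ∧ `stub_pairCorrelation` (Poisson-order truncated pair correlation at mesoscopic separation) ⟹ `stub_partTwo`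
(`partTwo_of_meanBands`, via the CLOSED glue p167966 / p145137), each leaf with its two kernel-checked consistency rungs (equilibrium, `s = 0`).
Rungs of this stub: equilibrium for every flow family (`StiffCollisionalRelaxationAprioriBoundsEquilibriumPartTwo`, PROVED); `s = 0` mean bands and
Poisson variance for every nice profile (p164149 / p164905).  Why it might fail: a transient mesoscopic vacuum / over-packed pocket with probability
`↛ 0` before `T` at some scale `N^{-γ}`, `γ ≤ 1/15` — excluded by nothing in the tree (dynamic moderate deviations at fixed `σ`; entropy vs the
invariant law prices a hole of radius `h` at `o(N)`), i.e. open in kind like 9201 itself. -/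
theorem stub_partTwo :
    ∀ (a₀ θ₀ : T3 → ℝ) (u₀ : T3 → V3), Continuous a₀ → Continuous θ₀ → Continuous u₀ →
      (∀ x, 0 < a₀ x) → (∀ x, 0 < θ₀ x) →
      ∃ σ₀ : ℝ, 0 < σ₀ ∧ ∃ η₁ : ℝ, 0 < η₁ ∧ ∀ σ : ℝ, 0 < σ → σ < σ₀ →
        ∀ (T : ℝ) (ρ θ : ℝ → T3 → ℝ) (u : ℝ → T3 → V3), IsHardSphereEulerSolution σ T ρ u θ →
        ∀ Φ : (N : ℕ) → HardSphereFlow (Torus.geometry (Fin 3)) (hsDiameter σ N) (N + 1),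
          TendstoHydroFieldsAt (fun N => localGibbsLaw σ a₀ u₀ θ₀ N (Φ N)) Φ ρ u θ 0 →
          ∀ t : ℝ, 0 < t → t < T → (∀ s ∈ Icc 0 t, ∀ x, 2 * ρ s x * σ ^ 3 < η₁) →
            PartTwoAt σ a₀ θ₀ u₀ Φ t := by
  sorry




/-- STUB 4 `mesoVariance_of_pairCorrelation` (CLOSED — landed p167966, wave 1 of cycle 3, with the exact identity `variance_blockDensity_eq_diag_add_cov`, the converse `pairCorrelation_of_mesoVariance` and the rungs `pairCorrelation_homogeneous` / `pairCorrelation_timeZero`; was: PROVABLE NOW, M — the exchangeability glue of the (ii)-half).  For `0 < σ ≤ 1/2`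
(probability laws), nice profiles, ANY flow family, horizon `t` and kernel family with the admissible block (only measurability via
`IsSmooth.continuous`, `0 ≤ φ_N ≤ C(N+1)^{3γ}` are used): an order-one MEAN CEILING `E ρ̄_φ(s,x) ≤ B` (eventually, uniformly on
`[0,t] × 𝕋³`; fed by stub 2 with `B = κ/σ³`) and the PAIR CORRELATION bound of stub 3 give r2-stub 3's conclusion verbatim:
`MemLp ρ̄ 2` (bounded measurable) and `Var_{P_N} ρ̄_φ(s,x) ≤ A(N+1)^{3γ−1}` with `A := C·B + max A′ 0`, `N₀ := max (max N_B N_{A′}) 1`.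
Plan: `ρ̄ = (N+1)⁻¹∑ᵢ gᵢ`, `gᵢ(z) = φ_N(((Φ N).flow s z i).1 − x)` (`empiricalDensityField` unfolded through `integral_empiricalMeasure` /
`empiricalMeasure_eq`: a finite average); ONE-TIME EXCHANGEABILITY of the evolved law: `E[gᵢ] = E[g₀]`, `E[gᵢ²] = E[g₀²]`, `E[gᵢgⱼ] =
E[g₀g₁]` (`i ≠ j`) by `ShearStressHalfDrudeRelabel.integral_twoTime_comp_perm_localGibbsLaw` with `H(z,w) := F(w k, w l)` (pattern:
`integral_self_twoTime_eq`, `integral_pair_twoTime_eq`, `sum_sum_integral_twoTime_eq` in the same file); expand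
`Var ρ̄ = E ρ̄² − (E ρ̄)²` (`variance_def'` for `MemLp 2`), `E ρ̄² = (N+1)⁻²((N+1)E g₀² + (N+1)N E g₀g₁)`, `E ρ̄ = E g₀`, regroup with
`(N+1)⁻¹ + N/(N+1) = 1`: `Var ρ̄ = (N+1)⁻¹(E g₀² − (E g₀)²) + (N/(N+1))(E g₀g₁ − E g₀ E g₁)`; bound `E g₀² ≤ C(N+1)^{3γ} E g₀ =
C(N+1)^{3γ} E ρ̄ ≤ C B (N+1)^{3γ}`, drop `−(E g₀)² ≤ 0`, and `(N/(N+1))·Cov ≤ max A′ 0 · (N+1)^{3γ−1}`.  Integrability: every `gᵢ` is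
measurable (`(Φ N).measurable_flow s`, continuity of `φ_N`) and bounded by `C(N+1)^{3γ}` under a probability law. -/
theorem stub_mesoVariance_of_pairCorrelation :
    ∀ (σ : ℝ) (a₀ θ₀ : T3 → ℝ) (u₀ : T3 → V3)
      (Φ : (N : ℕ) → HardSphereFlow (Torus.geometry (Fin 3)) (hsDiameter σ N) (N + 1)) (t : ℝ),
      0 < σ → σ ≤ 1 / 2 → NiceProfiles a₀ θ₀ u₀ →
      ∀ (γ C : ℝ) (φ : ℕ → T3 → ℝ), 0 < γ →
        ((∀ N, Literature.Analysis.FunctionSpaces.Torus.IsSmooth (φ N)) ∧ (∀ N y, 0 ≤ φ N y) ∧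
          (∀ N, ∫ y, φ N y = 1) ∧
          (∀ (N : ℕ) y, ((N : ℝ) + 1) ^ (-γ) ≤ Torus.euclidDist y 0 → φ N y = 0) ∧
          (∀ (N : ℕ) y, φ N y ≤ C * ((N : ℝ) + 1) ^ (3 * γ)) ∧
          (∀ (N : ℕ) y, ‖Literature.Analysis.FunctionSpaces.Torus.gradient (φ N) y‖ ≤
            C * ((N : ℝ) + 1) ^ (4 * γ))) →
        (∃ B : ℝ, ∃ N₀ : ℕ, ∀ N : ℕ, N₀ ≤ N → ∀ s ∈ Icc 0 t, ∀ x : T3,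
          ∫ z, empiricalDensityField ((Φ N).flow s z) (fun y => φ N (y - x))
            ∂(localGibbsLaw σ a₀ u₀ θ₀ N (Φ N)) ≤ B) →
        (∃ A : ℝ, ∃ N₀ : ℕ, ∀ N : ℕ, N₀ ≤ N → ∀ s ∈ Icc 0 t, ∀ x : T3,
          (∫ z, φ N (((Φ N).flow s z 0).1 - x) * φ N (((Φ N).flow s z 1).1 - x)
              ∂(localGibbsLaw σ a₀ u₀ θ₀ N (Φ N))) -
            (∫ z, φ N (((Φ N).flow s z 0).1 - x) ∂(localGibbsLaw σ a₀ u₀ θ₀ N (Φ N))) *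
              (∫ z, φ N (((Φ N).flow s z 1).1 - x) ∂(localGibbsLaw σ a₀ u₀ θ₀ N (Φ N))) ≤
          A * ((N : ℝ) + 1) ^ (3 * γ - 1)) →
        ∃ A : ℝ, ∃ N₀ : ℕ, ∀ N : ℕ, N₀ ≤ N → ∀ s ∈ Icc 0 t, ∀ x : T3,
          MemLp (fun z => empiricalDensityField ((Φ N).flow s z) (fun y => φ N (y - x))) 2
              (localGibbsLaw σ a₀ u₀ θ₀ N (Φ N)) ∧
            variance (fun z => empiricalDensityField ((Φ N).flow s z) (fun y => φ N (y - x)))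
              (localGibbsLaw σ a₀ u₀ θ₀ N (Φ N)) ≤ A * ((N : ℝ) + 1) ^ (3 * γ - 1) :=
  -- CLOSED (wave 1 of cycle 3, p167966): `Theorems/StiffCollisionalRelaxationAprioriBoundsMesoPairCorrelationGlue.lean`
  Theorems.MesoChebyshevWindow.stub_mesoVariance_of_pairCorrelation

/-- STUB 4 `partTwo_of_meanVariance` (CLOSED — landed p145137 with tools p143177/p144405; was: PROVABLE NOW, L — THE FIRST LEMMA, the mesoscopic Chebyshev window).  For
`0 < σ ≤ 1/2` (probability laws, `isProbabilityMeasure_localGibbsLaw`), nice profiles, `t > 0`, ANY flow family, and a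
bounded-energy-per-sphere event at time `0` (supplied under the crux prefix by the `t = 0` LLN, `energyBound_of_lln` below):
for every admissible kernel family, FLOOR in the mean (stub 1's conclusion) ∧ CEILING in the mean (stub 2's) ∧ Poisson VARIANCE
(stub 3's) ⟹ component (ii) at this instance, with `c₁ := m/2`.  Plan (all tools LANDED): `δ := min (m/8) ((1−κ)/(4σ³))`;
(a) `P_N(goodᶜ) = 0` (`ae_mem_good_localGibbsLaw`), and on good orbits `(Φ N).flow s z ∈ good ⊆ hardSphereDomain`, i.e. the
centres are `ε_N = σ(N+1)^{-1/3}`-separated in `Torus.euclidDist` (`norm_geometry_sepVec`); (b) SPATIAL MODULUS on separated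
configurations: `|ρ̄_w(x) − ρ̄_w(x′)| ≤ (N+1)⁻¹ · #{i : euclidDist x qᵢ < 2h} · √3 C(N+1)^{4γ}‖x − x′‖` for `‖x − x′‖` small
(`Torus.abs_sub_le_of_norm_gradient_le`, support clause via `euclidDist_sub_zero'`-type translation, `dist_le_euclidDist`), and
`#{…} ≤ ((2h + ε/2)/(ε/2))³ ≤ 125(N+1)^{1−3γ}/σ³` once `2h + ε/2 < 1/2` (`NearConstantShortTimeHL.card_filter_near_le`), so
`L_x ≤ 125√3 C σ⁻³ (N+1)^{γ}`; (c) TIME MODULUS on good orbits: `|ρ̄(s′,x) − ρ̄(s,x)| ≤ (N+1)⁻¹ √3 C(N+1)^{4γ} ∑ᵢ d(qᵢ(s′),qᵢ(s))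
≤ √3 C (N+1)^{4γ} √(2E/(N+1)) (s′ − s)` (`IsHardSphereTrajectory.sum_euclidDist_le_of_le`, `configEnergy_eq_holds`; `E/(N+1) =
empiricalEnergyField · 1 ≤ E₀` off the energy event); (d) GRID: the lattice `(n⁻¹ℤ³) mod 1` with `n ≍ L_x/δ` (`n³ = O(σ⁻⁹δ⁻³(N+1)^{3γ})`
points, sup-norm mesh `1/(2n)`) × `{j r_s} ∩ [0,t]`, `r_s = δ/L_s` (`O(t δ⁻¹ (N+1)^{4γ})` points); (e) CHEBYSHEV at each grid point
(`ProbabilityTheory.meas_ge_le_variance_div_sq`, `MemLp` from stub 3): `P(|ρ̄ − Eρ̄| ≥ δ) ≤ A(N+1)^{3γ−1}/δ²`; union over the grid: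
`O((N+1)^{10γ−1}) → 0` since `γ ≤ 1/15 < 1/10` (`tendsto_rpow_neg_atTop`-type); (f) OFF the union of the grid events, the energy
event and `goodᶜ`, for all `s ∈ [0,t]`, `x`: `ρ̄(s,x) > m − 3δ ≥ 5m/8 > c₁` and `ρ̄(s,x)σ³ < κ + 3δσ³ ≤ κ + 3(1−κ)/4 < 1` (uses
`mσ³ ≤ κ < 1` from stubs 1–2 at a grid point); the uncountable `∃ s ∃ x` event is bounded by MONOTONICITY of the measure (it is
contained in the finite union), no measurability of the sup needed (TRIAGE-r2-1 (3)).  Exponent audit (two triagers, independently):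
with the crude count `#ball ≤ N+1` the budget is `(N+1)^{19γ−1} = N^{+4/15}` at `γ = 1/15` — the packing lemma IS load-bearing. -/
theorem stub_partTwo_of_meanVariance :
    ∀ (σ : ℝ) (a₀ θ₀ : T3 → ℝ) (u₀ : T3 → V3)
      (Φ : (N : ℕ) → HardSphereFlow (Torus.geometry (Fin 3)) (hsDiameter σ N) (N + 1)) (t : ℝ),
      0 < σ → σ ≤ 1 / 2 → NiceProfiles a₀ θ₀ u₀ → 0 < t →
      (∃ E₀ : ℝ, Tendsto (fun N : ℕ => localGibbsLaw σ a₀ u₀ θ₀ N (Φ N)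
          {z | E₀ < empiricalEnergyField ((Φ N).flow 0 z) (fun _ => 1)}) atTop (𝓝 0)) →
      ∀ (γ C : ℝ) (φ : ℕ → T3 → ℝ), 0 < γ → γ ≤ 1 / 15 →
        ((∀ N, Literature.Analysis.FunctionSpaces.Torus.IsSmooth (φ N)) ∧ (∀ N y, 0 ≤ φ N y) ∧
          (∀ N, ∫ y, φ N y = 1) ∧
          (∀ (N : ℕ) y, ((N : ℝ) + 1) ^ (-γ) ≤ Torus.euclidDist y 0 → φ N y = 0) ∧
          (∀ (N : ℕ) y, φ N y ≤ C * ((N : ℝ) + 1) ^ (3 * γ)) ∧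
          (∀ (N : ℕ) y, ‖Literature.Analysis.FunctionSpaces.Torus.gradient (φ N) y‖ ≤
            C * ((N : ℝ) + 1) ^ (4 * γ))) →
        (∃ m : ℝ, 0 < m ∧ ∃ N₀ : ℕ, ∀ N : ℕ, N₀ ≤ N → ∀ s ∈ Icc 0 t, ∀ x : T3,
          m ≤ ∫ z, empiricalDensityField ((Φ N).flow s z) (fun y => φ N (y - x))
            ∂(localGibbsLaw σ a₀ u₀ θ₀ N (Φ N))) →
        (∃ κ : ℝ, κ < 1 ∧ ∃ N₀ : ℕ, ∀ N : ℕ, N₀ ≤ N → ∀ s ∈ Icc 0 t, ∀ x : T3,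
          (∫ z, empiricalDensityField ((Φ N).flow s z) (fun y => φ N (y - x))
            ∂(localGibbsLaw σ a₀ u₀ θ₀ N (Φ N))) * σ ^ 3 ≤ κ) →
        (∃ A : ℝ, ∃ N₀ : ℕ, ∀ N : ℕ, N₀ ≤ N → ∀ s ∈ Icc 0 t, ∀ x : T3,
          MemLp (fun z => empiricalDensityField ((Φ N).flow s z) (fun y => φ N (y - x))) 2
              (localGibbsLaw σ a₀ u₀ θ₀ N (Φ N)) ∧
            variance (fun z => empiricalDensityField ((Φ N).flow s z) (fun y => φ N (y - x)))
              (localGibbsLaw σ a₀ u₀ θ₀ N (Φ N)) ≤ A * ((N : ℝ) + 1) ^ (3 * γ - 1)) →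
        ∃ c₁ : ℝ, 0 < c₁ ∧ Tendsto (fun N : ℕ => localGibbsLaw σ a₀ u₀ θ₀ N (Φ N)
          {z | ∃ s ∈ Icc 0 t, ∃ x : T3,
            empiricalDensityField ((Φ N).flow s z) (fun y => φ N (y - x)) < c₁ ∨
              1 < empiricalDensityField ((Φ N).flow s z) (fun y => φ N (y - x)) * σ ^ 3}) atTop (𝓝 0) :=
  -- CLOSED (wave 1, p145137): `Theorems/StiffCollisionalRelaxationAprioriBoundsMesoPartTwoOfMeanVariance.lean`
  Theorems.MesoChebyshevWindow.stub_partTwo_of_meanVariance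

/-- STUB 5 `farTailAll` (OPEN — the SIZE input of component (i): far tails at ALL levels in the MEAN, `FarTailAllAt`:
`E_N ∫₀ᵗ frac_K ds ≤ t·A·e^{−K/(2Θ)}` eventually in `N`, for all `K`).  Producer: the PRE-SHOCK tail item
`UGibbsSRBRigidity.GaussianTails` (stmt-14415) through the landed Markov–Tonelli glue `farTailAll_of_gaussianTails` (p137042).
BYTE-IDENTICAL to `Lines/tail_occupation_variance.lean`'s (and the dead fibre line's) `stub_farTailAll` — one registered
obligation serves every line. -/
theorem stub_farTailAll :
    ∀ (a₀ θ₀ : T3 → ℝ) (u₀ : T3 → V3), Continuous a₀ → Continuous θ₀ → Continuous u₀ →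
      (∀ x, 0 < a₀ x) → (∀ x, 0 < θ₀ x) →
      ∃ σ₀ : ℝ, 0 < σ₀ ∧ ∃ η₁ : ℝ, 0 < η₁ ∧ ∀ σ : ℝ, 0 < σ → σ < σ₀ →
        ∀ (T : ℝ) (ρ θ : ℝ → T3 → ℝ) (u : ℝ → T3 → V3), IsHardSphereEulerSolution σ T ρ u θ →
        ∀ Φ : (N : ℕ) → HardSphereFlow (Torus.geometry (Fin 3)) (hsDiameter σ N) (N + 1),
          TendstoHydroFieldsAt (fun N => localGibbsLaw σ a₀ u₀ θ₀ N (Φ N)) Φ ρ u θ 0 →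
          ∀ t : ℝ, 0 < t → t < T → (∀ s ∈ Icc 0 t, ∀ x, 2 * ρ s x * σ ^ 3 < η₁) →
            FarTailAllAt σ a₀ θ₀ u₀ Φ t := by
  sorry

/-- STUB 6 `occupationInProb` (OPEN — NEW in r4, replaces r3-stub 6 `pairDecorrelation` as the REGISTERED (i)-concentration stub;
NECESSARY FOR THE CRUX: `occupationInProb_of_aprioriBounds`, lead c11's `…MesoOccupationInProbExact.lean`).  Under the crux prefix:
the IN-PROBABILITY OCCUPATION PROFILE of the time-integrated one-particle tail occupations `occ_K = ∫₀ᵗ frac_K(Φ_s ·) ds ∈ [0,t]`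
— `∃ Θ > 0, A, ∀ K, ∀ η > 0, P_N{ t·A·e^{−K/(2Θ)} + η < occ_K } → 0` — verbatim the hypothesis of the CLOSED dial (stub 7,
`stub_partOne_of_occupation`, p142615).  One-sided (upper deviations only), per level, bounded observable, no limit identified, no rate.
EXACT: given `FarTailAllAt` (stub 5 ⇐ 14415), `PartOneAt ⟺ stub 6 at the instance` (`partOne_iff_occupationInProb`); the crux implies
it under its own prefix with the same thresholds.  Producers (all landed as glue): r2 `occupationVariance` ∧ stub 5 (Chebyshev,
`stub_occupationInProb_of_variance` p142450; `occupationInProb_of` below) ⟸ r3 `pairDecorrelation` (p168171) ⟸ `FixedTimeTailVariance`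
(p168597) ⟸ stmt-17603 (p168989).  Rungs: equilibrium for every flow family (`occupationInProb_homogeneous`, from the PROVED
equilibrium (i)); `K ≤ 0` trivial (`occ ≡ t ≤ tA + η` once `A ≥ 1`).  Why it might fail: only together with the crux — it is
positive-time in-probability control of the far velocity tails of deterministic hard spheres at fixed `σ` on Euler times
(HighMomentumCutoff barrier: entropy vs the invariant law bounds exponentially-rare events by `O(1)`, never `o(1)`); every
printed production (Lanford / Pulvirenti–Simonella / BGSS) is Boltzmann–Grad on kinetic times. -/
theorem stub_occupationInProb :
    ∀ (a₀ θ₀ : T3 → ℝ) (u₀ : T3 → V3), Continuous a₀ → Continuous θ₀ → Continuous u₀ →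
      (∀ x, 0 < a₀ x) → (∀ x, 0 < θ₀ x) →
      ∃ σ₀ : ℝ, 0 < σ₀ ∧ ∃ η₁ : ℝ, 0 < η₁ ∧ ∀ σ : ℝ, 0 < σ → σ < σ₀ →
        ∀ (T : ℝ) (ρ θ : ℝ → T3 → ℝ) (u : ℝ → T3 → V3), IsHardSphereEulerSolution σ T ρ u θ →
        ∀ Φ : (N : ℕ) → HardSphereFlow (Torus.geometry (Fin 3)) (hsDiameter σ N) (N + 1),
          TendstoHydroFieldsAt (fun N => localGibbsLaw σ a₀ u₀ θ₀ N (Φ N)) Φ ρ u θ 0 →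
          ∀ t : ℝ, 0 < t → t < T → (∀ s ∈ Icc 0 t, ∀ x, 2 * ρ s x * σ ^ 3 < η₁) →
            ∃ Θ A : ℝ, 0 < Θ ∧ ∀ K : ℝ, ∀ η : ℝ, 0 < η →
              Tendsto (fun N : ℕ => localGibbsLaw σ a₀ u₀ θ₀ N (Φ N)
                {z | t * A * Real.exp (-(K / (2 * Θ))) + η <
                  (∫⁻ s in Icc 0 t, ENNReal.ofReal (frac K ((Φ N).flow s z))).toReal}) atTop (𝓝 0) := by
  sorry


/-- STUB 7 `occupationVariance_of_pairDecorrelation` (CLOSED — landed p168171, wave 1 of cycle 3, with the exact identity `variance_occ_eq_diag_add_cov`, the converse `pairDecorrelation_of_occupationVariance` and the rung `pairDecorrelation_homogeneous`; was: PROVABLE NOW, M–L — the exchangeability glue of the (i)-half).  For `0 < σ ≤ 1/2`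
(probability laws), nice profiles, `t > 0`, ANY flow family and every level `K`: `Cov_{P_N}(ζ₀^K, ζ₁^K) → 0` (stub 6's conclusion at `K`)
implies `Var_{P_N} occ_K → 0` (r2-stub 6's conclusion at `K`).  Plan: (a) WINDOW EXCHANGEABILITY: for `P_N`-a.e. `z` and all `s ≥ 0`
simultaneously `Φ_s(z ∘ π) = (Φ_s z) ∘ π` (`ShearStressHalfDrudeRelabel.ae_forall_flow_comp_perm_of_nonneg_localGibbsLaw`), so
`ζᵢ(z ∘ π) = ζ_{π i}(z)` a.e. (the sojourn only reads `s ∈ Icc 0 t`, `s ≥ 0`), and relabelling preserves `P_N`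
(`EvenStressEnskog.integral_comp_perm_localGibbsLaw`): `E[ζᵢ] = E[ζ₀]`, `E[ζᵢ²] = E[ζ₀²]`, `E[ζᵢζⱼ] = E[ζ₀ζ₁]` (`i ≠ j`; permutations as in
`integral_pair_twoTime_eq`); (b) `occ_K = (N+1)⁻¹∑ᵢ ζᵢ` on good orbits (`frac_eq_avg`; `ENNReal.ofReal` of a finite average of `{0,1}`-valued
terms; `lintegral_finset_sum` + `lintegral_const_mul` — the summands `s ↦ 𝟙{K ≤ |vᵢ(s)|²}` are measurable along every good orbit by joint
measurability `HardSphereFlow.measurable_flow_prod_torus` composed with `s ↦ (⟨z, hz⟩, s)`; good orbits carry `P_N`,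
`ae_mem_good_localGibbsLaw`), each `ζᵢ ∈ [0, t]` (`lintegral` of a `[0,1]`-valued function over `Icc 0 t`); (c) `Var occ_K = E occ² − (E occ)²`
(`occupation_memLp_and_integral_eq` gives `MemLp 2`), expand the square of the average, use (a): `Var occ_K = (N+1)⁻¹ Var ζ₀ +
(N/(N+1)) Cov(ζ₀,ζ₁) ≤ t²/(N+1) + |Cov(ζ₀,ζ₁)|`; (d) squeeze: `t²/(N+1) → 0` and the hypothesis. -/
theorem stub_occupationVariance_of_pairDecorrelation :
    ∀ (σ : ℝ) (a₀ θ₀ : T3 → ℝ) (u₀ : T3 → V3)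
      (Φ : (N : ℕ) → HardSphereFlow (Torus.geometry (Fin 3)) (hsDiameter σ N) (N + 1)) (t : ℝ),
      0 < σ → σ ≤ 1 / 2 → NiceProfiles a₀ θ₀ u₀ → 0 < t →
      ∀ K : ℝ,
        Tendsto (fun N : ℕ =>
          (∫ z, (∫⁻ s in Icc 0 t, ENNReal.ofReal (if K ≤ ‖((Φ N).flow s z 0).2‖ ^ 2 then (1 : ℝ) else 0)).toReal *
              (∫⁻ s in Icc 0 t, ENNReal.ofReal (if K ≤ ‖((Φ N).flow s z 1).2‖ ^ 2 then (1 : ℝ) else 0)).toReal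
              ∂(localGibbsLaw σ a₀ u₀ θ₀ N (Φ N))) -
            (∫ z, (∫⁻ s in Icc 0 t, ENNReal.ofReal (if K ≤ ‖((Φ N).flow s z 0).2‖ ^ 2 then (1 : ℝ) else 0)).toReal
              ∂(localGibbsLaw σ a₀ u₀ θ₀ N (Φ N))) *
            (∫ z, (∫⁻ s in Icc 0 t, ENNReal.ofReal (if K ≤ ‖((Φ N).flow s z 1).2‖ ^ 2 then (1 : ℝ) else 0)).toReal
              ∂(localGibbsLaw σ a₀ u₀ θ₀ N (Φ N)))) atTop (𝓝 0) →
        Tendsto (fun N : ℕ => variance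
          (fun z => (∫⁻ s in Icc 0 t, ENNReal.ofReal (frac K ((Φ N).flow s z))).toReal)
          (localGibbsLaw σ a₀ u₀ θ₀ N (Φ N))) atTop (𝓝 0) :=
  -- CLOSED (wave 1 of cycle 3, p168171): `Theorems/StiffCollisionalRelaxationAprioriBoundsMesoPairDecorrelationGlue.lean`
  Theorems.MesoChebyshevWindow.stub_occupationVariance_of_pairDecorrelation

/-- STUB 7 `partOne_of_occupation` (CLOSED — landed p142615, lead a2, cycle 1; = stub 5 of `Lines/tail_occupation_variance.lean` and of
`Lines/local_units_on_the_kinetic_box.lean`; in r4 it is THE (i)-glue: stub 6 `occupationInProb` ∧ `FarTailAllAt` ⟹ `PartOneAt`, by the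
λ-dial — layer cake over integer levels, a fixed level cut, Markov on the geometric top from the far tails in the mean, and the bottom
levels SURELY off the finitely many occupation events, whose probabilities vanish by stub 6; threshold `C := t·A⁺e^{λ}/(1 − e^{−(1/(2Θ)−λ)}) + 1`). -/
theorem stub_partOne_of_occupation :
    ∀ (σ : ℝ) (a₀ θ₀ : T3 → ℝ) (u₀ : T3 → V3)
      (Φ : (N : ℕ) → HardSphereFlow (Torus.geometry (Fin 3)) (hsDiameter σ N) (N + 1)) (t : ℝ),
      0 < σ → σ ≤ 1 / 2 → NiceProfiles a₀ θ₀ u₀ → 0 < t →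
      (∃ Θ A : ℝ, 0 < Θ ∧ ∀ K : ℝ, ∀ η : ℝ, 0 < η →
          Tendsto (fun N : ℕ => localGibbsLaw σ a₀ u₀ θ₀ N (Φ N)
            {z | t * A * Real.exp (-(K / (2 * Θ))) + η <
              (∫⁻ s in Icc 0 t, ENNReal.ofReal (frac K ((Φ N).flow s z))).toReal}) atTop (𝓝 0)) →
      FarTailAllAt σ a₀ θ₀ u₀ Φ t → PartOneAt σ a₀ θ₀ u₀ Φ t :=
  -- CLOSED (p142615): `Theorems/StiffCollisionalRelaxationAprioriBoundsMesoPartOneOfOccupation.lean`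
  Theorems.MesoChebyshevWindow.stub_partOne_of_occupation

/-- STUB 7 `partOne_of_varianceTails` (CLOSED — landed: `stub_occupationInProb_of_variance` p142450, `stub_partOne_of_occupation` p142615, composition p145949; was: PROVABLE NOW, M–L — Chebyshev at each level ∘ the λ-dial; it is EXACTLY the
composition of the registered provable-now stubs 4 (`stub_occupationInProb_of_variance`) and 5 (`stub_partOne_of_occupation`) of
`Lines/tail_occupation_variance.lean`, whose docstrings carry the full plans and whose landing closes this stub in two lines).
For `0 < σ ≤ 1/2`, nice profiles, `t > 0`, any flow family: vanishing variances of the time-integrated occupations at every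
level (stub 6's conclusion) and far tails in the mean (`FarTailAllAt`, stub 5's conclusion) give `PartOneAt`.  Plan: Chebyshev
(`meas_ge_le_variance_div_sq`; `occ_K` measurable via `HardSphereFlow.measurable_flow_prod_torus` + `measurable_frac`, `≤ t` by
`frac_mem_Icc`, hence `MemLp 2`; `E occ_K ≤ tAe^{−K/2Θ}` from `FarTailAllAt`) gives `P_N{tAe^{−K/2Θ} + η < occ_K} → 0` for all
`K`, `η > 0`; then `λ := 1/(4Θ)`, layer cake `(N+1)⁻¹∑ᵢe^{λ|vᵢ|²} ≤ ∑_{K∈ℕ} e^{λ(K+1)} frac_K`, Tonelli, `Cexp := ∑_K e^{λ(K+1)}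
tAe^{−K/2Θ} + 1`, level cut `M(ε)` with Markov on the geometric top and the `M+1` Chebyshev events with `η_K := e^{−λ(K+1)}/(2(M+1))`
on the bottom: `limsup ≤ ε/2` for every `ε`.  Template/tools: landed `Theorems.FibreDeficitTransfer.stub_partOnePrime` /
`partOne_markov_step` (`pp_sum_range_exp_mul_exp_neg_le`, `pp_lintegral_orbit_expAvg_le`, `measure_timeAvg_gt_le_of_trunc`). -/
theorem stub_partOne_of_varianceTails :
    ∀ (σ : ℝ) (a₀ θ₀ : T3 → ℝ) (u₀ : T3 → V3)
      (Φ : (N : ℕ) → HardSphereFlow (Torus.geometry (Fin 3)) (hsDiameter σ N) (N + 1)) (t : ℝ),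
      0 < σ → σ ≤ 1 / 2 → NiceProfiles a₀ θ₀ u₀ → 0 < t →
      (∀ K : ℝ, Tendsto (fun N : ℕ => variance
          (fun z => (∫⁻ s in Icc 0 t, ENNReal.ofReal (frac K ((Φ N).flow s z))).toReal)
          (localGibbsLaw σ a₀ u₀ θ₀ N (Φ N))) atTop (𝓝 0)) →
      FarTailAllAt σ a₀ θ₀ u₀ Φ t → PartOneAt σ a₀ θ₀ u₀ Φ t :=
  -- CLOSED (wave 1, p142450 ∘ p142615; assembled p145949):
  -- `Theorems/StiffCollisionalRelaxationAprioriBoundsMesoPartOneOfVarianceTails.lean`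
  Theorems.MesoChebyshevWindow.stub_partOne_of_varianceTails

end Holds

/-! ## Stub statements by name -/

/-- Statement of registered stub II (`Holds.stub_partTwo`, r5 — the EXACT (ii)-residue). -/
def stub_partTwo : Prop := type_of% Holds.stub_partTwo
/-- (ii)-LEAF 1 `meanFloor`, BY NAME (r1–r4 registered stub 1; in r5 a DOCK of `stub_partTwo` via `partTwo_of_meanBands`; ⇐ stmt-9201 p142675; NECESSARY for (ii), `meanFloor_of_partTwo`).  Under the crux prefix, for
every admissible kernel family: a FLOOR IN THE MEAN, uniform on the space–time grid — `∃ m > 0 ∃ N₀ ∀ N ≥ N₀ ∀ s ∈ [0,t] ∀ x,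
m ≤ E_{P_N} ρ̄_φ(s,x)` ("no kernel cell is evacuated ON AVERAGE").  One-body, first-moment, one-sided with slack (`m → 0`), no
Euler field named: implied by in-mean mesoscopic hydrodynamics at scale `N^{-γ}` (not conversely) and NOT implied by the
(macroscopic, rate-free) conjunct; implied by (ii) itself (`E ρ̄ ≥ c₁ P(good event)`), so strictly weaker than the crux's (ii).
Equilibrium unit test: `E ρ̄_φ(s,x) = ∫ φ_N = 1` (HomogeneousInvariance), `m = 1` (p142677); `t = 0` rung for EVERY nice
profile: `tzMean_meanFloor_timeZero` (p164149, `m = min ρ₀/2`, ρ₀ the identified LLN density `rhoLim`).  Why it might fail: it is positive-time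
no-evacuation IN THE MEAN for deterministic hard spheres at fixed `σ` — weaker than every typed hydrodynamic statement but with
no producer cheaper than in-mean hydrodynamics at mesoscale; entropy vs the invariant law does NOT give it (a hole of radius `h`
in the one-body marginal costs relative entropy `≍ h³ → 0`, TRIAGE-r2-2 sharpen (2)). -/
def stub_meanFloor : Prop :=
    ∀ (a₀ θ₀ : T3 → ℝ) (u₀ : T3 → V3), Continuous a₀ → Continuous θ₀ → Continuous u₀ →
      (∀ x, 0 < a₀ x) → (∀ x, 0 < θ₀ x) →
      ∃ σ₀ : ℝ, 0 < σ₀ ∧ ∃ η₁ : ℝ, 0 < η₁ ∧ ∀ σ : ℝ, 0 < σ → σ < σ₀ →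
        ∀ (T : ℝ) (ρ θ : ℝ → T3 → ℝ) (u : ℝ → T3 → V3), IsHardSphereEulerSolution σ T ρ u θ →
        ∀ Φ : (N : ℕ) → HardSphereFlow (Torus.geometry (Fin 3)) (hsDiameter σ N) (N + 1),
          TendstoHydroFieldsAt (fun N => localGibbsLaw σ a₀ u₀ θ₀ N (Φ N)) Φ ρ u θ 0 →
          ∀ t : ℝ, 0 < t → t < T → (∀ s ∈ Icc 0 t, ∀ x, 2 * ρ s x * σ ^ 3 < η₁) →
          ∀ (γ C : ℝ) (φ : ℕ → T3 → ℝ), 0 < γ → γ ≤ 1 / 15 →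
            ((∀ N, Literature.Analysis.FunctionSpaces.Torus.IsSmooth (φ N)) ∧ (∀ N y, 0 ≤ φ N y) ∧
              (∀ N, ∫ y, φ N y = 1) ∧
              (∀ (N : ℕ) y, ((N : ℝ) + 1) ^ (-γ) ≤ Torus.euclidDist y 0 → φ N y = 0) ∧
              (∀ (N : ℕ) y, φ N y ≤ C * ((N : ℝ) + 1) ^ (3 * γ)) ∧
              (∀ (N : ℕ) y, ‖Literature.Analysis.FunctionSpaces.Torus.gradient (φ N) y‖ ≤
                C * ((N : ℝ) + 1) ^ (4 * γ))) →
            ∃ m : ℝ, 0 < m ∧ ∃ N₀ : ℕ, ∀ N : ℕ, N₀ ≤ N → ∀ s ∈ Icc 0 t, ∀ x : T3,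
              m ≤ ∫ z, empiricalDensityField ((Φ N).flow s z) (fun y => φ N (y - x))
                ∂(localGibbsLaw σ a₀ u₀ θ₀ N (Φ N))
/-- (ii)-LEAF 2 `meanCeiling`, BY NAME (r1–r4 registered stub 2; in r5 a DOCK of `stub_partTwo` via `partTwo_of_meanBands`; ⇐ stmt-9201 p143118).  Under the crux prefix, for every admissible kernel family: a CEILING IN THE MEAN,
uniform on the grid, RELATIVE TO PACKING — `∃ κ < 1 ∃ N₀ ∀ N ≥ N₀ ∀ s ∈ [0,t] ∀ x, E_{P_N} ρ̄_φ(s,x) · σ³ ≤ κ` (`∃ κ < 1` is the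
weakest threshold the composition consumes; typing checklist (iv)).  The stub's prover chooses `σ₀` and `η₁`, so the chamber
clause `ρ_Euler < η₁/(2σ³)` on `[0,t]` is available with any slack: the natural input is an in-mean bound RELATIVE to the Euler
density, `E ρ̄_φ(s,x) ≤ Λ · sup_{[0,s]×𝕋³} ρ_Euler + o(1)` with `Λ = Λ(profiles)` fixed before `σ` (then `η₁ ≤ 1/(2Λ)` gives
`κ = 3/4`, say) — TRIAGE-r2-1 sharpen (1); the dock in print-shape is a uniformly bounded one-sphere SCORE RESPONSE along the
pre-shock homotopy read at mesoscale (`OneSphereInfluence.ScoreLinearResponse` stmt-13617-type statement, anchored at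
`HomogeneousInvariance` 9621 where `E ρ̄ = 1`; the mesoscale, (s,x)-uniform version is a NEW statement, open).  Equilibrium unit
test: `E ρ̄ σ³ = σ³ ≤ 1/8` (p142800); `t = 0` rung for every nice profile: `tzMean_meanCeiling_timeZero` (p164149, `2Mσ³ ≤ 1/2`).  Almost implied by (ii) (`E ρ̄ ≤ σ⁻³(P(good) + C(N+1)^{3γ}P(bad))`, i.e. `κ = 1 + o(1)` — misses
`κ < 1` exactly by the slack), not implied by the conjunct.  Why it might fail: a persistent mesoscopic over-compression IN THE
MEAN before `T` (mean kernel density `≥ σ⁻³` somewhere on `[0,t]` while the Euler density stays `< η₁/(2σ³)`) — excluded by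
nothing in the tree; it is in-mean anti-clustering at scale `N^{-γ}`, open like every positive-time input here. -/
def stub_meanCeiling : Prop :=
    ∀ (a₀ θ₀ : T3 → ℝ) (u₀ : T3 → V3), Continuous a₀ → Continuous θ₀ → Continuous u₀ →
      (∀ x, 0 < a₀ x) → (∀ x, 0 < θ₀ x) →
      ∃ σ₀ : ℝ, 0 < σ₀ ∧ ∃ η₁ : ℝ, 0 < η₁ ∧ ∀ σ : ℝ, 0 < σ → σ < σ₀ →
        ∀ (T : ℝ) (ρ θ : ℝ → T3 → ℝ) (u : ℝ → T3 → V3), IsHardSphereEulerSolution σ T ρ u θ →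
        ∀ Φ : (N : ℕ) → HardSphereFlow (Torus.geometry (Fin 3)) (hsDiameter σ N) (N + 1),
          TendstoHydroFieldsAt (fun N => localGibbsLaw σ a₀ u₀ θ₀ N (Φ N)) Φ ρ u θ 0 →
          ∀ t : ℝ, 0 < t → t < T → (∀ s ∈ Icc 0 t, ∀ x, 2 * ρ s x * σ ^ 3 < η₁) →
          ∀ (γ C : ℝ) (φ : ℕ → T3 → ℝ), 0 < γ → γ ≤ 1 / 15 →
            ((∀ N, Literature.Analysis.FunctionSpaces.Torus.IsSmooth (φ N)) ∧ (∀ N y, 0 ≤ φ N y) ∧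
              (∀ N, ∫ y, φ N y = 1) ∧
              (∀ (N : ℕ) y, ((N : ℝ) + 1) ^ (-γ) ≤ Torus.euclidDist y 0 → φ N y = 0) ∧
              (∀ (N : ℕ) y, φ N y ≤ C * ((N : ℝ) + 1) ^ (3 * γ)) ∧
              (∀ (N : ℕ) y, ‖Literature.Analysis.FunctionSpaces.Torus.gradient (φ N) y‖ ≤
                C * ((N : ℝ) + 1) ^ (4 * γ))) →
            ∃ κ : ℝ, κ < 1 ∧ ∃ N₀ : ℕ, ∀ N : ℕ, N₀ ≤ N → ∀ s ∈ Icc 0 t, ∀ x : T3,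
              (∫ z, empiricalDensityField ((Φ N).flow s z) (fun y => φ N (y - x))
                ∂(localGibbsLaw σ a₀ u₀ θ₀ N (Φ N))) * σ ^ 3 ≤ κ
/-- (ii)-LEAF 3 `pairCorrelation`, BY NAME (r3–r4 registered stub 3; in r5 a DOCK of `stub_partTwo` via `partTwo_of_meanBands`; no producer, moot under 9201; AFTER CYCLE 3: both rungs landed (`pairCorrelation_homogeneous`, `pairCorrelation_timeZero`, p167966), presearch none at fixed σ / Euler times, no dock — consumed only by the 9201-free (ii); replaces r2-stub 3 `mesoVariance` by its off-diagonal part).  Under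
the crux prefix, for every admissible kernel family: `∃ A ∃ N₀ ∀ N ≥ N₀ ∀ s ∈ [0,t] ∀ x`,
  `E_{P_N}[φ_N(q₀(s)−x) φ_N(q₁(s)−x)] − E_{P_N}[φ_N(q₀(s)−x)] · E_{P_N}[φ_N(q₁(s)−x)] ≤ A (N+1)^{3γ−1}`
— the EQUAL-TIME TRUNCATED PAIR CORRELATION of two tagged spheres at positive times, tested against `φ_N ⊗ φ_N` (each factor of `L¹`-size
`≍ E ρ̄` and sup `C(N+1)^{3γ}`), i.e. `∬ φ_N(y−x)φ_N(y′−x) [ρ_N^{(2)}(s;y,y′) − ρ_N^{(1)}(s;y)ρ_N^{(1)}(s;y′)] dy dy′ = O(N^{3γ−1})`: a bound of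
POISSON ORDER on the second cumulant of the evolved law at mesoscopic separation, with a FREE constant `A(profiles, σ, Φ, t, kernel family)`.
By the exchangeability identity `Var ρ̄ = (N+1)⁻¹Var g₀ + (N/(N+1))Cov(g₀,g₁)` it is EQUIVALENT, given the mean ceiling of stub 2, to r2-stub 3
(`⟸`: stub 4 below; `⟹`: `Cov ≤ ((N+1)/N)Var`), so both consistency rungs are inherited: TRUE at equilibrium for every flow family
(p148322: canonical hard-core gas, `ρ_T^{(2)} = O(1/N) + O(exclusion at |y−y′| < ε_N)`, `∬φφ·ε_N³‖φ‖_∞ ≍ σ³N^{3γ−1}`) and TRUE at `s = 0`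
for every nice profile (p164905, quantitative inhomogeneous cluster expansion).  Why Poisson order is the physical prediction pre-shock for
`γ < 1/6`: the kernel-scale pair correlation at time `s` is the linearised-Euler image of the initial one plus the local-equilibrium
exclusion part, both `O(N^{3γ−1})` against `φ_N ⊗ φ_N` (Spohn 1991 II.7; the Dorfman–Kirkpatrick–Sengers long-range enhancement is a
steady-state law with build-up time `≫ t`, TRIAGE-r2-2 (3)).  Nearest print: correlation-error / second-cumulant bounds for TAGGED hard
spheres are known only in the Boltzmann–Grad scaling on kinetic times (Pulvirenti–Simonella, Invent. Math. 207 (2017); Bodineau–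
Gallagher–Saint-Raymond–Simonella, Ann. Math. 198 (2023), cumulant of order 2 `= O(1/μ_ε)`); here each sphere suffers `≍ σ²N^{1/3}t → ∞`
collisions — no producer, no dock (fixed-time Efron–Stein certifies only `N^{5γ−1/3}`, TRIAGE-r2-2 (1)).  Why it might fail: an
`N`-independent or slowly decaying mesoscale pair correlation building up before `T` would give `Cov ≫ N^{3γ−1}`; growth `≥ N^{1−10γ}`
relative to Poisson kills the composition at `γ = 1/15`. -/
def stub_pairCorrelation : Prop :=
    ∀ (a₀ θ₀ : T3 → ℝ) (u₀ : T3 → V3), Continuous a₀ → Continuous θ₀ → Continuous u₀ →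
      (∀ x, 0 < a₀ x) → (∀ x, 0 < θ₀ x) →
      ∃ σ₀ : ℝ, 0 < σ₀ ∧ ∃ η₁ : ℝ, 0 < η₁ ∧ ∀ σ : ℝ, 0 < σ → σ < σ₀ →
        ∀ (T : ℝ) (ρ θ : ℝ → T3 → ℝ) (u : ℝ → T3 → V3), IsHardSphereEulerSolution σ T ρ u θ →
        ∀ Φ : (N : ℕ) → HardSphereFlow (Torus.geometry (Fin 3)) (hsDiameter σ N) (N + 1),
          TendstoHydroFieldsAt (fun N => localGibbsLaw σ a₀ u₀ θ₀ N (Φ N)) Φ ρ u θ 0 →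
          ∀ t : ℝ, 0 < t → t < T → (∀ s ∈ Icc 0 t, ∀ x, 2 * ρ s x * σ ^ 3 < η₁) →
          ∀ (γ C : ℝ) (φ : ℕ → T3 → ℝ), 0 < γ → γ ≤ 1 / 15 →
            ((∀ N, Literature.Analysis.FunctionSpaces.Torus.IsSmooth (φ N)) ∧ (∀ N y, 0 ≤ φ N y) ∧
              (∀ N, ∫ y, φ N y = 1) ∧
              (∀ (N : ℕ) y, ((N : ℝ) + 1) ^ (-γ) ≤ Torus.euclidDist y 0 → φ N y = 0) ∧
              (∀ (N : ℕ) y, φ N y ≤ C * ((N : ℝ) + 1) ^ (3 * γ)) ∧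
              (∀ (N : ℕ) y, ‖Literature.Analysis.FunctionSpaces.Torus.gradient (φ N) y‖ ≤
                C * ((N : ℝ) + 1) ^ (4 * γ))) →
            ∃ A : ℝ, ∃ N₀ : ℕ, ∀ N : ℕ, N₀ ≤ N → ∀ s ∈ Icc 0 t, ∀ x : T3,
              (∫ z, φ N (((Φ N).flow s z 0).1 - x) * φ N (((Φ N).flow s z 1).1 - x)
                  ∂(localGibbsLaw σ a₀ u₀ θ₀ N (Φ N))) -
                (∫ z, φ N (((Φ N).flow s z 0).1 - x) ∂(localGibbsLaw σ a₀ u₀ θ₀ N (Φ N))) *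
                  (∫ z, φ N (((Φ N).flow s z 1).1 - x) ∂(localGibbsLaw σ a₀ u₀ θ₀ N (Φ N))) ≤
              A * ((N : ℝ) + 1) ^ (3 * γ - 1)
/-- Statement of registered stub 4 (`Holds.stub_mesoVariance_of_pairCorrelation`, r3, provable now). -/
def stub_mesoVariance_of_pairCorrelation : Prop := type_of% Holds.stub_mesoVariance_of_pairCorrelation
/-- Statement of the CLOSED r1-stub `Holds.stub_partTwo_of_meanVariance` (p145137). -/
def stub_partTwo_of_meanVariance : Prop := type_of% Holds.stub_partTwo_of_meanVariance
/-- Statement of registered stub 5 (`Holds.stub_farTailAll`). -/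
def stub_farTailAll : Prop := type_of% Holds.stub_farTailAll
/-- Statement of registered stub 6 (`Holds.stub_occupationInProb`, r4 — the EXACT (i)-residue). -/
def stub_occupationInProb : Prop := type_of% Holds.stub_occupationInProb
/-- Statement of the CLOSED stub 7 (`Holds.stub_partOne_of_occupation`, p142615). -/
def stub_partOne_of_occupation : Prop := type_of% Holds.stub_partOne_of_occupation
/-- Statement of the CLOSED r3-stub 7 (`Holds.stub_occupationVariance_of_pairDecorrelation`, p168171). -/
def stub_occupationVariance_of_pairDecorrelation : Prop := type_of% Holds.stub_occupationVariance_of_pairDecorrelation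

/-- Statement of r3-stub 6 `pairDecorrelation` (`Cov_{P_N}(ζ₀^K, ζ₁^K) → 0` for every level `K` under the crux prefix — decorrelation of
two tagged spheres' time-averaged tail sojourns; TRUE at equilibrium p168171, DOCKED ⇐ stmt-17603 p168989 and ⇐ `FixedTimeTailVariance`
p168597), kept BY NAME as a DOCK of the r4 stub 6: `occupationInProb_of (… (occupationVariance_of hD _))`. -/
def stub_pairDecorrelation : Prop :=
    ∀ (a₀ θ₀ : T3 → ℝ) (u₀ : T3 → V3), Continuous a₀ → Continuous θ₀ → Continuous u₀ →
      (∀ x, 0 < a₀ x) → (∀ x, 0 < θ₀ x) →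
      ∃ σ₀ : ℝ, 0 < σ₀ ∧ ∃ η₁ : ℝ, 0 < η₁ ∧ ∀ σ : ℝ, 0 < σ → σ < σ₀ →
        ∀ (T : ℝ) (ρ θ : ℝ → T3 → ℝ) (u : ℝ → T3 → V3), IsHardSphereEulerSolution σ T ρ u θ →
        ∀ Φ : (N : ℕ) → HardSphereFlow (Torus.geometry (Fin 3)) (hsDiameter σ N) (N + 1),
          TendstoHydroFieldsAt (fun N => localGibbsLaw σ a₀ u₀ θ₀ N (Φ N)) Φ ρ u θ 0 →
          ∀ t : ℝ, 0 < t → t < T → (∀ s ∈ Icc 0 t, ∀ x, 2 * ρ s x * σ ^ 3 < η₁) →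
            ∀ K : ℝ, Tendsto (fun N : ℕ =>
              (∫ z, (∫⁻ s in Icc 0 t, ENNReal.ofReal (if K ≤ ‖((Φ N).flow s z 0).2‖ ^ 2 then (1 : ℝ) else 0)).toReal *
                  (∫⁻ s in Icc 0 t, ENNReal.ofReal (if K ≤ ‖((Φ N).flow s z 1).2‖ ^ 2 then (1 : ℝ) else 0)).toReal
                  ∂(localGibbsLaw σ a₀ u₀ θ₀ N (Φ N))) -
                (∫ z, (∫⁻ s in Icc 0 t, ENNReal.ofReal (if K ≤ ‖((Φ N).flow s z 0).2‖ ^ 2 then (1 : ℝ) else 0)).toReal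
                  ∂(localGibbsLaw σ a₀ u₀ θ₀ N (Φ N))) *
                (∫ z, (∫⁻ s in Icc 0 t, ENNReal.ofReal (if K ≤ ‖((Φ N).flow s z 1).2‖ ^ 2 then (1 : ℝ) else 0)).toReal
                  ∂(localGibbsLaw σ a₀ u₀ θ₀ N (Φ N)))) atTop (𝓝 0)
/-- Statement of the CLOSED r1-stub `Holds.stub_partOne_of_varianceTails` (p145949). -/
def stub_partOne_of_varianceTails : Prop := type_of% Holds.stub_partOne_of_varianceTails

/-! ## The r2 statements BY NAME, derived from the r3 stubs (sorry-free glue) -/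

/-- Statement of r2-stub 3 `mesoVariance` (the Poisson-order variance `Var_{P_N} ρ̄_φ(s,x) ≤ A(N+1)^{3γ−1}` under the crux prefix; TRUE at
equilibrium p148322 and at `s = 0` for every nice profile p164905), kept BY NAME for the landed capstones (`AprioriBounds_of_meso_stubs`,
`partTwo_of_meanBands_mesoVariance`, p147849); in r3 it is DERIVED (`mesoVariance_of`). -/
def stub_mesoVariance : Prop :=
    ∀ (a₀ θ₀ : T3 → ℝ) (u₀ : T3 → V3), Continuous a₀ → Continuous θ₀ → Continuous u₀ →
      (∀ x, 0 < a₀ x) → (∀ x, 0 < θ₀ x) →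
      ∃ σ₀ : ℝ, 0 < σ₀ ∧ ∃ η₁ : ℝ, 0 < η₁ ∧ ∀ σ : ℝ, 0 < σ → σ < σ₀ →
        ∀ (T : ℝ) (ρ θ : ℝ → T3 → ℝ) (u : ℝ → T3 → V3), IsHardSphereEulerSolution σ T ρ u θ →
        ∀ Φ : (N : ℕ) → HardSphereFlow (Torus.geometry (Fin 3)) (hsDiameter σ N) (N + 1),
          TendstoHydroFieldsAt (fun N => localGibbsLaw σ a₀ u₀ θ₀ N (Φ N)) Φ ρ u θ 0 →
          ∀ t : ℝ, 0 < t → t < T → (∀ s ∈ Icc 0 t, ∀ x, 2 * ρ s x * σ ^ 3 < η₁) →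
          ∀ (γ C : ℝ) (φ : ℕ → T3 → ℝ), 0 < γ → γ ≤ 1 / 15 →
            ((∀ N, Literature.Analysis.FunctionSpaces.Torus.IsSmooth (φ N)) ∧ (∀ N y, 0 ≤ φ N y) ∧
              (∀ N, ∫ y, φ N y = 1) ∧
              (∀ (N : ℕ) y, ((N : ℝ) + 1) ^ (-γ) ≤ Torus.euclidDist y 0 → φ N y = 0) ∧
              (∀ (N : ℕ) y, φ N y ≤ C * ((N : ℝ) + 1) ^ (3 * γ)) ∧
              (∀ (N : ℕ) y, ‖Literature.Analysis.FunctionSpaces.Torus.gradient (φ N) y‖ ≤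
                C * ((N : ℝ) + 1) ^ (4 * γ))) →
            ∃ A : ℝ, ∃ N₀ : ℕ, ∀ N : ℕ, N₀ ≤ N → ∀ s ∈ Icc 0 t, ∀ x : T3,
              MemLp (fun z => empiricalDensityField ((Φ N).flow s z) (fun y => φ N (y - x))) 2
                  (localGibbsLaw σ a₀ u₀ θ₀ N (Φ N)) ∧
                variance (fun z => empiricalDensityField ((Φ N).flow s z) (fun y => φ N (y - x)))
                  (localGibbsLaw σ a₀ u₀ θ₀ N (Φ N)) ≤ A * ((N : ℝ) + 1) ^ (3 * γ - 1)

/-- Statement of r2-stub 6 `occupationVariance` (= the D3 child `OccupationVariance`: `Var_{P_N} occ_K → 0` for every `K` under the crux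
prefix; TRUE at equilibrium p143623), kept BY NAME for the landed capstones (`AprioriBounds_of_KRC_GT_occupationVariance`, p147849); in r3 it
is DERIVED (`occupationVariance_of`). -/
def stub_occupationVariance : Prop :=
    ∀ (a₀ θ₀ : T3 → ℝ) (u₀ : T3 → V3), Continuous a₀ → Continuous θ₀ → Continuous u₀ →
      (∀ x, 0 < a₀ x) → (∀ x, 0 < θ₀ x) →
      ∃ σ₀ : ℝ, 0 < σ₀ ∧ ∃ η₁ : ℝ, 0 < η₁ ∧ ∀ σ : ℝ, 0 < σ → σ < σ₀ →
        ∀ (T : ℝ) (ρ θ : ℝ → T3 → ℝ) (u : ℝ → T3 → V3), IsHardSphereEulerSolution σ T ρ u θ →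
        ∀ Φ : (N : ℕ) → HardSphereFlow (Torus.geometry (Fin 3)) (hsDiameter σ N) (N + 1),
          TendstoHydroFieldsAt (fun N => localGibbsLaw σ a₀ u₀ θ₀ N (Φ N)) Φ ρ u θ 0 →
          ∀ t : ℝ, 0 < t → t < T → (∀ s ∈ Icc 0 t, ∀ x, 2 * ρ s x * σ ^ 3 < η₁) →
            ∀ K : ℝ, Tendsto (fun N : ℕ => variance
              (fun z => (∫⁻ s in Icc 0 t, ENNReal.ofReal (frac K ((Φ N).flow s z))).toReal)
              (localGibbsLaw σ a₀ u₀ θ₀ N (Φ N))) atTop (𝓝 0)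

/-- r2-stub 3 DERIVED: mean ceiling (stub 2) ∧ pair correlation (stub 3) ⟹ Poisson-order variance, by the exchangeability glue (stub 4);
`σ₀ := min (min σ₂ σ₃) (1/2)`, `η₁ := min η₂ η₃`, `B := κ/σ³`. -/
theorem mesoVariance_of (hC : stub_meanCeiling) (hP : stub_pairCorrelation) (hG : stub_mesoVariance_of_pairCorrelation) :
    stub_mesoVariance := by
  intro a₀ θ₀ u₀ ha hθ hu ha0 hθ0
  have hprof : NiceProfiles a₀ θ₀ u₀ := ⟨ha, hθ, hu, ha0, hθ0⟩
  obtain ⟨σ₂, hσ₂, η₂, hη₂, H2⟩ := (hC : stub_meanCeiling) a₀ θ₀ u₀ ha hθ hu ha0 hθ0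
  obtain ⟨σ₃, hσ₃, η₃, hη₃, H3⟩ := (hP : stub_pairCorrelation) a₀ θ₀ u₀ ha hθ hu ha0 hθ0
  refine ⟨min (min σ₂ σ₃) (1 / 2), lt_min (lt_min hσ₂ hσ₃) one_half_pos, min η₂ η₃, lt_min hη₂ hη₃, ?_⟩
  intro σ hσ hσlt T ρ θ u hsol Φ hLLN t ht htT hdil γ C φ hγ hγ' hadm
  simp only [lt_min_iff] at hσlt hdil
  obtain ⟨⟨hs2, hs3⟩, hshalf⟩ := hσlt
  obtain ⟨κ, _hκ, N₂, hN₂⟩ :=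
    H2 σ hσ hs2 T ρ θ u hsol Φ hLLN t ht htT (fun s hs x => (hdil s hs x).1) γ C φ hγ hγ' hadm
  have hPC := H3 σ hσ hs3 T ρ θ u hsol Φ hLLN t ht htT (fun s hs x => (hdil s hs x).2) γ C φ hγ hγ' hadm
  have hσ3 : 0 < σ ^ 3 := pow_pos hσ 3
  have hB : ∃ B : ℝ, ∃ N₀ : ℕ, ∀ N : ℕ, N₀ ≤ N → ∀ s ∈ Icc 0 t, ∀ x : T3,
      ∫ z, empiricalDensityField ((Φ N).flow s z) (fun y => φ N (y - x))
        ∂(localGibbsLaw σ a₀ u₀ θ₀ N (Φ N)) ≤ B := by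
    refine ⟨κ / σ ^ 3, N₂, fun N hN s hs x => ?_⟩
    rw [le_div_iff₀ hσ3]
    exact hN₂ N hN s hs x
  exact (hG : type_of% Holds.stub_mesoVariance_of_pairCorrelation) σ a₀ θ₀ u₀ Φ t hσ hshalf.le hprof γ C φ hγ
    hadm hB hPC

/-- r2-stub 6 (= D3 child `OccupationVariance`) DERIVED: pair decorrelation (stub 6) ⟹ vanishing occupation variance, by the
exchangeability glue (stub 7); `σ₀ := min σ₆ (1/2)`, `η₁ := η₆`. -/
theorem occupationVariance_of (hD : stub_pairDecorrelation) (hG : stub_occupationVariance_of_pairDecorrelation) :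
    stub_occupationVariance := by
  intro a₀ θ₀ u₀ ha hθ hu ha0 hθ0
  have hprof : NiceProfiles a₀ θ₀ u₀ := ⟨ha, hθ, hu, ha0, hθ0⟩
  obtain ⟨σ₆, hσ₆, η₆, hη₆, H6⟩ := (hD : stub_pairDecorrelation) a₀ θ₀ u₀ ha hθ hu ha0 hθ0
  refine ⟨min σ₆ (1 / 2), lt_min hσ₆ one_half_pos, η₆, hη₆, ?_⟩
  intro σ hσ hσlt T ρ θ u hsol Φ hLLN t ht htT hdil K
  simp only [lt_min_iff] at hσlt
  have hcov := H6 σ hσ hσlt.1 T ρ θ u hsol Φ hLLN t ht htT hdil K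
  exact (hG : type_of% Holds.stub_occupationVariance_of_pairDecorrelation) σ a₀ θ₀ u₀ Φ t hσ hσlt.2.le hprof ht K hcov

/-- r4-stub 6 DERIVED FROM THE r2/r3 CHILDREN (the dock): far tails in the mean (stub 5) ∧ vanishing occupation variances (r2-stub 6,
itself ⇐ r3 `pairDecorrelation` by `occupationVariance_of`) ⟹ the in-probability occupation profile, by Chebyshev at each level
(`Theorems.MesoChebyshevWindow.stub_occupationInProb_of_variance`, p142450); `σ₀ := min (min σ₅ σ₆) (1/2)`, `η₁ := min η₅ η₆`. -/
theorem occupationInProb_of (h5 : stub_farTailAll) (hO : stub_occupationVariance) : stub_occupationInProb := by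
  intro a₀ θ₀ u₀ ha hθ hu ha0 hθ0
  have hP : NiceProfiles a₀ θ₀ u₀ := ⟨ha, hθ, hu, ha0, hθ0⟩
  obtain ⟨σ₅, hσ₅, η₅, hη₅, H5⟩ := (h5 : type_of% Holds.stub_farTailAll) a₀ θ₀ u₀ ha hθ hu ha0 hθ0
  obtain ⟨σ₆, hσ₆, η₆, hη₆, H6⟩ := (hO : stub_occupationVariance) a₀ θ₀ u₀ ha hθ hu ha0 hθ0
  refine ⟨min (min σ₅ σ₆) (1 / 2), lt_min (lt_min hσ₅ hσ₆) one_half_pos, min η₅ η₆, lt_min hη₅ hη₆, ?_⟩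
  intro σ hσ hσlt T ρ θ u hsol Φ hLLN t ht htT hdil
  simp only [lt_min_iff] at hσlt hdil
  obtain ⟨⟨hs5, hs6⟩, hshalf⟩ := hσlt
  have hFar : FarTailAllAt σ a₀ θ₀ u₀ Φ t :=
    H5 σ hσ hs5 T ρ θ u hsol Φ hLLN t ht htT (fun s hs x => (hdil s hs x).1)
  have hVar := H6 σ hσ hs6 T ρ θ u hsol Φ hLLN t ht htT (fun s hs x => (hdil s hs x).2)
  exact Theorems.MesoChebyshevWindow.stub_occupationInProb_of_variance σ a₀ θ₀ u₀ Φ t hσ hshalf.le hP ht hVar hFar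

/-! ## Glue (sorry-free) -/

/-- **Bounded energy per sphere at time `0`, from the crux's own `t = 0` LLN.**  The third component of
`TendstoHydroFieldsAt … 0` at the test function `χ ≡ 1`, `δ = 1`: with `E₀ := ∫ E(0,·) + 1`,
`P_N{E₀ < (N+1)⁻¹ ∑ᵢ |vᵢ(0)|²/2} → 0`.  (Conservation along good orbits, `configEnergy_eq_holds`, carries it to every
`s` inside stub 4.) -/
theorem energyBound_of_lln {σ : ℝ} {a₀ θ₀ : T3 → ℝ} {u₀ : T3 → V3}
    {Φ : (N : ℕ) → HardSphereFlow (Torus.geometry (Fin 3)) (hsDiameter σ N) (N + 1)}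
    {ρ θ : ℝ → T3 → ℝ} {u : ℝ → T3 → V3}
    (h : TendstoHydroFieldsAt (fun N => localGibbsLaw σ a₀ u₀ θ₀ N (Φ N)) Φ ρ u θ 0) :
    ∃ E₀ : ℝ, Tendsto (fun N : ℕ => localGibbsLaw σ a₀ u₀ θ₀ N (Φ N)
      {z | E₀ < empiricalEnergyField ((Φ N).flow 0 z) (fun _ => 1)}) atTop (𝓝 0) := by
  refine ⟨(∫ x, (fun _ : T3 => (1 : ℝ)) x * totalEnergyDensity (ρ 0 x) (u 0 x) (θ 0 x)) + 1, ?_⟩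
  have h1 := ((h (fun _ => (1 : ℝ)) continuous_const 1 one_pos).2).2
  refine tendsto_of_tendsto_of_tendsto_of_le_of_le tendsto_const_nhds h1 (fun _ => zero_le) ?_
  intro N
  refine measure_mono fun z hz => ?_
  simp only [Set.mem_setOf_eq] at hz ⊢
  exact lt_abs.2 (Or.inl (by linarith))

/-- Component (ii) under the crux prefix from stubs 1 (floor), 2 (ceiling), 3 (variance) and the CLOSED stub 4 (Chebyshev window):
`σ₀ := min (min σ₁ σ₂) (min σ₃ (1/2))`, `η₁ := min (min η₁ η₂) η₃`. -/
theorem partTwo_of (hF : stub_meanFloor) (hC : stub_meanCeiling) (hV : stub_mesoVariance) :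
    ∀ (a₀ θ₀ : T3 → ℝ) (u₀ : T3 → V3), Continuous a₀ → Continuous θ₀ → Continuous u₀ →
      (∀ x, 0 < a₀ x) → (∀ x, 0 < θ₀ x) →
      ∃ σ₀ : ℝ, 0 < σ₀ ∧ ∃ η₁ : ℝ, 0 < η₁ ∧ ∀ σ : ℝ, 0 < σ → σ < σ₀ →
        ∀ (T : ℝ) (ρ θ : ℝ → T3 → ℝ) (u : ℝ → T3 → V3), IsHardSphereEulerSolution σ T ρ u θ →
        ∀ Φ : (N : ℕ) → HardSphereFlow (Torus.geometry (Fin 3)) (hsDiameter σ N) (N + 1),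
          TendstoHydroFieldsAt (fun N => localGibbsLaw σ a₀ u₀ θ₀ N (Φ N)) Φ ρ u θ 0 →
          ∀ t : ℝ, 0 < t → t < T → (∀ s ∈ Icc 0 t, ∀ x, 2 * ρ s x * σ ^ 3 < η₁) →
            PartTwoAt σ a₀ θ₀ u₀ Φ t := by
  intro a₀ θ₀ u₀ ha hθ hu ha0 hθ0
  have hP : NiceProfiles a₀ θ₀ u₀ := ⟨ha, hθ, hu, ha0, hθ0⟩
  obtain ⟨σ₁, hσ₁, η₁, hη₁, H1⟩ := (hF : stub_meanFloor) a₀ θ₀ u₀ ha hθ hu ha0 hθ0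
  obtain ⟨σ₂, hσ₂, η₂, hη₂, H2⟩ := (hC : stub_meanCeiling) a₀ θ₀ u₀ ha hθ hu ha0 hθ0
  obtain ⟨σ₃, hσ₃, η₃, hη₃, H3⟩ := (hV : stub_mesoVariance) a₀ θ₀ u₀ ha hθ hu ha0 hθ0
  have H4 : type_of% Holds.stub_partTwo_of_meanVariance := Holds.stub_partTwo_of_meanVariance  -- CLOSED (p145137)
  refine ⟨min (min σ₁ σ₂) (min σ₃ (1 / 2)), lt_min (lt_min hσ₁ hσ₂) (lt_min hσ₃ one_half_pos),
    min (min η₁ η₂) η₃, lt_min (lt_min hη₁ hη₂) hη₃, ?_⟩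
  intro σ hσ hσlt T ρ θ u hsol Φ hLLN t ht htT hdil
  simp only [lt_min_iff] at hσlt hdil
  obtain ⟨⟨hs1, hs2⟩, hs3, hshalf⟩ := hσlt
  intro γ C φ hγ hγ' hadm
  have hFl := H1 σ hσ hs1 T ρ θ u hsol Φ hLLN t ht htT (fun s hs x => (hdil s hs x).1.1) γ C φ hγ hγ' hadm
  have hCe := H2 σ hσ hs2 T ρ θ u hsol Φ hLLN t ht htT (fun s hs x => (hdil s hs x).1.2) γ C φ hγ hγ' hadm
  have hVa := H3 σ hσ hs3 T ρ θ u hsol Φ hLLN t ht htT (fun s hs x => (hdil s hs x).2) γ C φ hγ hγ' hadm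
  exact H4 σ a₀ θ₀ u₀ Φ t hσ hshalf.le hP ht (energyBound_of_lln hLLN) γ C φ hγ hγ' hadm hFl hCe hVa

/-- Component (i) under the crux prefix from stubs 5 (size) and 6 (the EXACT concentration stub `occupationInProb`), by the CLOSED
stub 7 (`stub_partOne_of_occupation`, p142615): `σ₀ := min (min σ₅ σ₆) (1/2)`, `η₁ := min η₅ η₆`. -/
theorem partOne_of (h5 : stub_farTailAll) (h6 : stub_occupationInProb) :
    ∀ (a₀ θ₀ : T3 → ℝ) (u₀ : T3 → V3), Continuous a₀ → Continuous θ₀ → Continuous u₀ →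
      (∀ x, 0 < a₀ x) → (∀ x, 0 < θ₀ x) →
      ∃ σ₀ : ℝ, 0 < σ₀ ∧ ∃ η₁ : ℝ, 0 < η₁ ∧ ∀ σ : ℝ, 0 < σ → σ < σ₀ →
        ∀ (T : ℝ) (ρ θ : ℝ → T3 → ℝ) (u : ℝ → T3 → V3), IsHardSphereEulerSolution σ T ρ u θ →
        ∀ Φ : (N : ℕ) → HardSphereFlow (Torus.geometry (Fin 3)) (hsDiameter σ N) (N + 1),
          TendstoHydroFieldsAt (fun N => localGibbsLaw σ a₀ u₀ θ₀ N (Φ N)) Φ ρ u θ 0 →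
          ∀ t : ℝ, 0 < t → t < T → (∀ s ∈ Icc 0 t, ∀ x, 2 * ρ s x * σ ^ 3 < η₁) →
            PartOneAt σ a₀ θ₀ u₀ Φ t := by
  intro a₀ θ₀ u₀ ha hθ hu ha0 hθ0
  have hP : NiceProfiles a₀ θ₀ u₀ := ⟨ha, hθ, hu, ha0, hθ0⟩
  obtain ⟨σ₅, hσ₅, η₅, hη₅, H5⟩ := (h5 : type_of% Holds.stub_farTailAll) a₀ θ₀ u₀ ha hθ hu ha0 hθ0
  obtain ⟨σ₆, hσ₆, η₆, hη₆, H6⟩ := (h6 : type_of% Holds.stub_occupationInProb) a₀ θ₀ u₀ ha hθ hu ha0 hθ0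
  have H7 : type_of% Holds.stub_partOne_of_occupation := Holds.stub_partOne_of_occupation  -- CLOSED (p142615)
  refine ⟨min (min σ₅ σ₆) (1 / 2), lt_min (lt_min hσ₅ hσ₆) one_half_pos,
    min η₅ η₆, lt_min hη₅ hη₆, ?_⟩
  intro σ hσ hσlt T ρ θ u hsol Φ hLLN t ht htT hdil
  simp only [lt_min_iff] at hσlt hdil
  obtain ⟨⟨hs5, hs6⟩, hshalf⟩ := hσlt
  have hFar : FarTailAllAt σ a₀ θ₀ u₀ Φ t :=
    H5 σ hσ hs5 T ρ θ u hsol Φ hLLN t ht htT (fun s hs x => (hdil s hs x).1)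
  have hOcc := H6 σ hσ hs6 T ρ θ u hsol Φ hLLN t ht htT (fun s hs x => (hdil s hs x).2)
  exact H7 σ a₀ θ₀ u₀ Φ t hσ hshalf.le hP ht hOcc hFar

/-- **The 9201-free (ii)-chain of this line, assembled**: the three by-name (ii)-leaves (floor in the mean ∧ ceiling in the mean ∧ Poisson-order
pair correlation) give the registered stub II through the CLOSED glue (p167966 exchangeability, p145137 mesoscopic Chebyshev window). -/
theorem partTwo_of_meanBands (h1 : stub_meanFloor) (h2 : stub_meanCeiling) (h3 : stub_pairCorrelation) : stub_partTwo :=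
  have h4 : stub_mesoVariance_of_pairCorrelation := Holds.stub_mesoVariance_of_pairCorrelation  -- CLOSED (p167966)
  partTwo_of h1 h2 (mesoVariance_of h2 h3 h4)

/-- **Stub II from the existing item `KineticRangeControl` (stmt-9201) alone** (landed dock `AdiabatCeiling.partTwo_of_kineticRangeControl`). -/
theorem partTwo_of_kineticRangeControl'
    (hK : Summit.AtomisticToContinuum.HydrodynamicLimit.Theses.GermanoSplitLES.KineticRangeControl) : stub_partTwo :=
  Theorems.AdiabatCeiling.partTwo_of_kineticRangeControl hK

/-- **Stub 5 from the existing item `GaussianTails` (stmt-14415)** (landed dock `FibreDeficitTransfer.farTailAll_of_gaussianTails`, p137042). -/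
theorem farTailAll_of_gaussianTails'
    (hG : Summit.AtomisticToContinuum.HydrodynamicLimit.Theses.UGibbsSRBRigidity.GaussianTails) : stub_farTailAll :=
  Theorems.FibreDeficitTransfer.farTailAll_of_gaussianTails hG

/-- **THE SKELETON THEOREM (r5).**  The three OPEN registered stubs — II `partTwo` (EXACT (ii)-residue; ⇐ stmt-9201, or ⇐ the line's three
(ii)-leaves), 5 `farTailAll` (⇐ stmt-14415), 6 `occupationInProb` (EXACT (i)-residue modulo stub 5) — imply the crux decl
`StiffCollisionalRelaxation.AprioriBounds` BY NAME, through the CLOSED dial (stub 7, p142615) and `aprioriBounds_of_partOne_partTwo` (p147849):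
`σ₀ := min σ_(i) σ_(ii)`, `η₁ := min η_(i) η_(ii)`.  Stubs II and 6 are NECESSARY for the conclusion (`stub_partTwo_of_aprioriBounds` below;
`Theorems.MesoChebyshevWindow.occupationInProb_of_aprioriBounds`, p172293). -/
theorem AprioriBounds_of (hII : stub_partTwo) (h5 : stub_farTailAll) (h6 : stub_occupationInProb) :
    Summit.AtomisticToContinuum.HydrodynamicLimit.Theses.StiffCollisionalRelaxation.AprioriBounds :=
  Theorems.MesoChebyshevWindow.aprioriBounds_of_partOne_partTwo (partOne_of h5 h6) hII

/-- The same skeleton closes the `CollisionIsometryCLT` copy of the crux (one `Prop`, `aprioriBoundsPreShock_iff`). -/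
theorem AprioriBoundsPreShock_of (hII : stub_partTwo) (h5 : stub_farTailAll) (h6 : stub_occupationInProb) :
    Summit.AtomisticToContinuum.HydrodynamicLimit.Theses.CollisionIsometryCLT.AprioriBoundsPreShock :=
  AprioriBounds_of hII h5 h6

/-! ## Exactness (sorry-free) -/

/-- **NECESSITY OF STUB II** (a conjunct of the crux, same thresholds). -/
theorem stub_partTwo_of_aprioriBounds
    (h : Summit.AtomisticToContinuum.HydrodynamicLimit.Theses.StiffCollisionalRelaxation.AprioriBounds) : stub_partTwo := by
  intro a₀ θ₀ u₀ ha hθ hu ha0 hθ0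
  obtain ⟨σ₀, hσ₀, η₁, hη₁, H⟩ := (Theorems.AprioriBoundsNegative.aprioriBounds_iff.1 h) a₀ θ₀ u₀ ha hθ hu ha0 hθ0
  exact ⟨σ₀, hσ₀, η₁, hη₁, fun σ hσ hσlt T ρ θ u hsol Φ hLLN t ht htT hdil =>
    (H σ hσ hσlt T ρ θ u hsol Φ hLLN t ht htT hdil).2⟩

/-- **NECESSITY OF STUB 6.**  The crux implies `stub_occupationInProb` (same thresholds): lead c11's
`Theorems.MesoChebyshevWindow.occupationInProb_of_aprioriBounds` (p172293; `e^{λK}·occ_K ≤ X_N` on good orbits). -/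
theorem stub_occupationInProb_of_aprioriBounds
    (h : Summit.AtomisticToContinuum.HydrodynamicLimit.Theses.StiffCollisionalRelaxation.AprioriBounds) : stub_occupationInProb :=
  Theorems.MesoChebyshevWindow.occupationInProb_of_aprioriBounds h

/-- **THE EXACT SPLIT: given far tails in the mean only (stub 5 ⇐ stmt-14415), `AprioriBounds ↔ stub_partTwo ∧ stub_occupationInProb`** — both
right-hand statements are corollaries of the crux and, with stub 5, give it back.  Importable twin with the item in place of stub 5:
`Theorems.MesoChebyshevWindow.aprioriBounds_iff_partTwo_and_occupationInProb_of_GT` (p172293). -/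
theorem aprioriBounds_iff_partTwo_and_occupationInProb (h5 : stub_farTailAll) :
    Summit.AtomisticToContinuum.HydrodynamicLimit.Theses.StiffCollisionalRelaxation.AprioriBounds ↔
      (stub_partTwo ∧ stub_occupationInProb) :=
  ⟨fun h => ⟨stub_partTwo_of_aprioriBounds h, stub_occupationInProb_of_aprioriBounds h⟩, fun h => AprioriBounds_of h.1 h5 h.2⟩

/-- **Given the (ii)-side (stub II, e.g. from stmt-9201) and far tails (stub 5), THE CRUX IS EQUIVALENT TO STUB 6.** -/
theorem aprioriBounds_iff_occupationInProb (hII : stub_partTwo) (h5 : stub_farTailAll) :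
    Summit.AtomisticToContinuum.HydrodynamicLimit.Theses.StiffCollisionalRelaxation.AprioriBounds ↔ stub_occupationInProb :=
  ⟨stub_occupationInProb_of_aprioriBounds, AprioriBounds_of hII h5⟩

/-! ## Earlier stub sets still close the crux (examples, so that the skeleton audit sees ONE skeleton theorem) -/

/-- r4's registered set (1, 2, 3, 5, 6). -/
example (h1 : stub_meanFloor) (h2 : stub_meanCeiling) (h3 : stub_pairCorrelation)
    (h5 : stub_farTailAll) (h6 : stub_occupationInProb) :
    Summit.AtomisticToContinuum.HydrodynamicLimit.Theses.StiffCollisionalRelaxation.AprioriBounds :=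
  AprioriBounds_of (partTwo_of_meanBands h1 h2 h3) h5 h6

/-- r3's registered set (1, 2, 3, 5, 6 = `pairDecorrelation`), through the dock `occupationInProb_of h5 (occupationVariance_of h6 h7)`
(r3-stub 7 CLOSED, p168171); importable twin: `Theorems.MesoChebyshevWindow.AprioriBounds_of_KRC_GT_pairDecorrelation` (p169401). -/
example (h1 : stub_meanFloor) (h2 : stub_meanCeiling) (h3 : stub_pairCorrelation)
    (h5 : stub_farTailAll) (h6 : stub_pairDecorrelation) :
    Summit.AtomisticToContinuum.HydrodynamicLimit.Theses.StiffCollisionalRelaxation.AprioriBounds :=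
  have h7 : stub_occupationVariance_of_pairDecorrelation :=
    Holds.stub_occupationVariance_of_pairDecorrelation  -- CLOSED (p168171)
  AprioriBounds_of (partTwo_of_meanBands h1 h2 h3) h5 (occupationInProb_of h5 (occupationVariance_of h6 h7))

-- The three EXISTING items 9201 ∧ 14415 ∧ 17603 close it too: `Theorems.MesoChebyshevWindow.AprioriBounds_of_KRC_GT_maxwellianOneBodyInBand`
-- (capstone p169401, `…MesoCapstonesR3.lean`, not imported here).

/-- D-0027 §3.3 shape: the crux from the registered stubs. -/
example : Summit.AtomisticToContinuum.HydrodynamicLimit.Theses.StiffCollisionalRelaxation.AprioriBounds :=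
  AprioriBounds_of Holds.stub_partTwo Holds.stub_farTailAll Holds.stub_occupationInProb

end Summit.AtomisticToContinuum.HydrodynamicLimit.Cruxes.AprioriBounds.MesoChebyshevWindow

end
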